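import Literature.Computability.FineGrained.MinPlusToNegativeTriangleQuery
import HarnessLib

/-!
# Distance product `≤₃` Negative Triangle (VW–W 2018, Thm. 4.2): the search of one round, verified

Semantics of the search part of the product step `psNT`
(`Literature.Computability.FineGrained.MinPlusToNegativeTriangleProgram`): the edge-deleting
search over triples of blocks of the proof of VW–W Lemma 4.2 (pp. 27:16–17), with a found pair
located by bisection of the row and column windows (in place of the recursive halving of
Lemma 4.1, pp. 27:14–15).

* `bisRows_spec`, `bisCols_spec`: the two bisections, by the loop rule with a potential
  (`ExecLE.whilenz_potential`) — the potential `(tAsk L + 13) · size (width - 1)` drops at every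
  halving (`size_half_lt`), so each costs at most `size (L - 1)` queries;
* `searchBody_spec`, `search_spec`: the search of one round. Invariant `SInv`: the triples below
  the counter have no witness left (`NoWit`), every stamped pair has its searched value below its
  threshold (soundness, `tval_lt_of_pairWit`), and the potential
  `(remaining triples + unfound pairs) · (tIter L + 2)` pays for every step — a no-answer retires
  a triple, a yes-answer stamps a pair that was unfound (VW–W p. 27:16: "the sum of all
  `e_{I'J'K'}` is at most `n²`, since … it is removed from the graph"); at the end every pair
  below its threshold is stamped (completeness, `found_of_tval_lt`), after at most
  `qSearch n L = (nb³ + n²)(1 + 2 size (L - 1))` queries and `tSearch n L` steps;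
* micro-lemmas for the straight-line pieces (`triple_spec`, `next_spec`, `mark_spec`, …) and
  the counting of unfound pairs (`unfound`, `unfound_update`, `unfoundMem_eq`).

## References

* V. Vassilevska Williams, R. R. Williams, *Subcubic equivalences between path, matrix, and
  triangle problems*, J. ACM 65 (2018), Art. 27: Lemma 4.1 (pp. 27:14–15), Lemma 4.2
  (p. 27:16; proof pp. 27:16–17), Thm. 4.2 (proof pp. 27:17–18). doi:10.1145/3186893
* T. Nipkow, G. Klein, *Concrete Semantics with Isabelle/HOL*, Springer 2014, §12.2 (loops with
  a variant / potential).
-/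

namespace Literature.Computability.FineGrained.NegTriStep

open Cryptography Cryptography.WordRAM Cryptography.WordRAM.SProg Matrix APSPPower

/-! ## Halving a window -/

/-- The size of a half: `size (k / 2) + 1 ≤ size k` for `k ≥ 1` (in fact equality). [folklore] -/
theorem size_div_two_lt {k : ℕ} (hk : 1 ≤ k) : Nat.size (k / 2) < Nat.size k := by
  have hs : 0 < Nat.size k := Nat.size_pos.2 hk
  have : k / 2 < 2 ^ (Nat.size k - 1) := by
    rw [Nat.div_lt_iff_lt_mul (by norm_num)]
    calc k < 2 ^ Nat.size k := Nat.lt_size_self k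
      _ = 2 ^ (Nat.size k - 1) * 2 := by rw [← pow_succ]; congr 1; omega
  have := Nat.size_le.2 this
  omega

/-- **Bisection shrinks the size of the width**: if a window of width `W ≥ 2` is replaced by one
of its halves `[lo, mid)` or `[mid, hi)`, `mid = (lo + hi) / 2`, then `size (width - 1)` drops. [folklore] -/
theorem size_half_lt {lo hi lo' hi' : ℕ} (h2 : lo + 2 ≤ hi)
    (h : (lo' = lo ∧ hi' = (lo + hi) / 2) ∨ (lo' = (lo + hi) / 2 ∧ hi' = hi)) :
    Nat.size (hi' - lo' - 1) < Nat.size (hi - lo - 1) := by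
  have key : hi' - lo' - 1 ≤ (hi - lo - 1) / 2 := by
    rcases h with ⟨rfl, rfl⟩ | ⟨rfl, rfl⟩ <;> omega
  exact lt_of_le_of_lt (Nat.size_le_size key) (size_div_two_lt (by omega))

/-! ## The environment of a round -/

variable {n : ℕ}

/-- **The facts about one round** (fixed during the search): well-formed operands, thresholds at
most `8M + 2`, the block side, the weight exponent of the oracle problem, and the operands in place. [folklore] -/
structure RFacts (c' : ℕ) (X Y : Matrix (Fin n) (Fin n) (WithTop ℤ)) (lo : ℕ → ℕ) (M pw L pX pY : ℕ)
    (H₀ : ℕ → ℕ) : Prop where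
  hX : HasBoundedWeights X M
  hY : HasBoundedWeights Y M
  hlo : ∀ t, t < n * n → lo t + pw ≤ 8 * M + 2
  hL : L = cubeRt n
  hL0 : 0 < L
  hbig : big M ≤ (3 * L) ^ c'
  hX0 : MatAt H₀ pX X
  hY0 : MatAt H₀ pY Y

variable {c' : ℕ} {X Y : Matrix (Fin n) (Fin n) (WithTop ℤ)} {lo : ℕ → ℕ} {M pw L pX pY : ℕ} {H₀ : ℕ → ℕ}

/-- The facts about a query of the round. [folklore] -/
theorem RFacts.qfacts (h : RFacts c' X Y lo M pw L pX pY H₀) (fd : ℕ → ℕ) {bi bj bk : ℕ}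
    (hbi : bi < nblk n) (hbj : bj < nblk n) (hbk : bk < nblk n) {rlo rhi clo chi : ℕ} (hrhi : rhi ≤ L)
    (hchi : chi ≤ L) : QFacts c' ((mkQ X Y lo fd M pw L bi bj bk).setWin rlo rhi clo chi) pX pY H₀ :=
  ⟨⟨h.hX, h.hY, h.hlo, h.hL0, h.hbig⟩, h.hL, hbi, hbj, hbk, hrhi, hchi, h.hX0, h.hY0⟩

section Bisect

variable {w : ℕ} {O : List ℕ → List ℕ} {F : ℕ}

set_option linter.unusedSimpArgs false in
/-- The first block of a bisection step on the window registers `a` (low) and `b` (high):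
`mid := (lo + hi) / 2` into `r51`, `hi` saved into `r52`, `b := mid`. [folklore] -/
theorem bisStep1_spec {S H : ℕ → ℕ} {qs : List (List ℕ)} {a b lo hi : ℕ} (ha : a < 100) (hb : b < 100)
    (hb5 : b ≠ 51 ∧ b ≠ 52) (hSa : S a = lo) (hSb : S b = hi)
    (hw : lo + hi < 2 ^ w) :
    ∃ S₁, Exec w O (block [(.add, .dir 51, .dir a, .dir b), (.shr, .dir 51, .dir 51, .imm 1),
        (.add, .dir 52, .dir b, .imm 0), (.add, .dir b, .dir 51, .imm 0)]) ⟨merge S H, qs⟩ ⟨merge S₁ H, qs⟩ 4 ∧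
      S₁ 51 = (lo + hi) / 2 ∧ S₁ 52 = hi ∧ S₁ b = (lo + hi) / 2 ∧ ∀ r, r ≠ b → r ≠ 51 → r ≠ 52 → S₁ r = S r := by
  have hmid : (lo + hi) / 2 ≤ lo + hi := Nat.div_le_self _ _
  obtain ⟨st₁, hex₁, S₁, rfl, h⟩ : ∃ st₁, Exec w O (block [(.add, .dir 51, .dir a, .dir b),
      (.shr, .dir 51, .dir 51, .imm 1), (.add, .dir 52, .dir b, .imm 0), (.add, .dir b, .dir 51, .imm 0)])
      ⟨merge S H, qs⟩ st₁ 4 ∧ ∃ S₁, st₁ = ⟨merge S₁ H, qs⟩ ∧ (S₁ 51 = (lo + hi) / 2 ∧ S₁ 52 = hi ∧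
        S₁ b = (lo + hi) / 2 ∧ ∀ r, r ≠ b → r ≠ 51 → r ≠ 52 → S₁ r = S r) := by
    refine Exec.block_of_fwd _ _ fun R hR => ?_
    have htmp := execOps_cons_fwd hR; clear hR; obtain ⟨v1, hv1, hR⟩ := htmp
    simp -failIfUnchanged (disch := omega) only [Operand.write, Operand.read, merge_apply_of_lt,
        merge_apply_of_le, Function.update_self, Function.update_of_ne, update_merge_of_lt,
        update_merge_of_le, Nat.add_zero, BinOp.eval_mod, BinOp.eval_eq, BinOp.eval_band,
        BinOp.eval_shr, BinOp.eval_div, BinOp.eval_lt, BinOp.eval_add_of_lt, BinOp.eval_sub_of_le,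
        BinOp.eval_mul_of_lt, hSa, hSb, merge_apply_of_lt ha, merge_apply_of_lt hb] at hv1 hR; subst hv1
    have htmp := execOps_cons_fwd hR; clear hR; obtain ⟨v2, hv2, hR⟩ := htmp
    simp -failIfUnchanged (disch := omega) only [Operand.write, Operand.read, merge_apply_of_lt,
        merge_apply_of_le, Function.update_self, Function.update_of_ne, update_merge_of_lt,
        update_merge_of_le, Nat.add_zero, BinOp.eval_mod, BinOp.eval_eq, BinOp.eval_band,
        BinOp.eval_shr, BinOp.eval_div, BinOp.eval_lt, BinOp.eval_add_of_lt, BinOp.eval_sub_of_le,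
        BinOp.eval_mul_of_lt, hSa, hSb, merge_apply_of_lt ha, merge_apply_of_lt hb] at hv2 hR
    have htmp := execOps_cons_fwd hR; clear hR; obtain ⟨v3, hv3, hR⟩ := htmp
    simp -failIfUnchanged (disch := omega) only [Operand.write, Operand.read, merge_apply_of_lt,
        merge_apply_of_le, Function.update_self, Function.update_of_ne, update_merge_of_lt,
        update_merge_of_le, Nat.add_zero, BinOp.eval_mod, BinOp.eval_eq, BinOp.eval_band,
        BinOp.eval_shr, BinOp.eval_div, BinOp.eval_lt, BinOp.eval_add_of_lt, BinOp.eval_sub_of_le,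
        BinOp.eval_mul_of_lt, hSa, hSb, merge_apply_of_lt ha, merge_apply_of_lt hb] at hv3 hR; subst hv3
    have htmp := execOps_cons_fwd hR; clear hR; obtain ⟨v4, hv4, hR⟩ := htmp
    simp -failIfUnchanged (disch := omega) only [Operand.write, Operand.read, merge_apply_of_lt,
        merge_apply_of_le, Function.update_self, Function.update_of_ne, update_merge_of_lt,
        update_merge_of_le, Nat.add_zero, BinOp.eval_mod, BinOp.eval_eq, BinOp.eval_band,
        BinOp.eval_shr, BinOp.eval_div, BinOp.eval_lt, BinOp.eval_add_of_lt, BinOp.eval_sub_of_le,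
        BinOp.eval_mul_of_lt, hSa, hSb, merge_apply_of_lt ha, merge_apply_of_lt hb] at hv4 hR; subst hv4
    simp only [execOps_nil] at hR; subst hR
    have hv2' : v2 = (lo + hi) / 2 := by rw [← hv2, Nat.shiftRight_one]
    subst hv2'
    refine ⟨_, rfl, ?_, ?_, ?_, fun r h1 h2 h3 => ?_⟩
    · rw [Function.update_of_ne (by omega), Function.update_of_ne (by omega), Function.update_self]
    · rw [Function.update_of_ne (by omega), Function.update_self]
    · rw [Function.update_self]
    · rw [Function.update_of_ne h1, Function.update_of_ne h3, Function.update_of_ne h2, Function.update_of_ne h2]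
  exact ⟨S₁, hex₁, h⟩

set_option linter.unusedSimpArgs false in
/-- Moving to the upper half: `a := r51 (= mid)`, `b := r52 (= hi)`. [folklore] -/
theorem bisStep2_spec {S H : ℕ → ℕ} {qs : List (List ℕ)} {a b mid hi : ℕ} (ha : a < 100) (hb : b < 100)
    (hab : a ≠ b) (ha5 : a ≠ 51 ∧ a ≠ 52) (hb5 : b ≠ 51 ∧ b ≠ 52) (h51 : S 51 = mid) (h52 : S 52 = hi)
    (hw : mid < 2 ^ w) (hw' : hi < 2 ^ w) :
    ∃ S₁, Exec w O (block [(.add, .dir a, .dir 51, .imm 0), (.add, .dir b, .dir 52, .imm 0)])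
        ⟨merge S H, qs⟩ ⟨merge S₁ H, qs⟩ 2 ∧
      S₁ a = mid ∧ S₁ b = hi ∧ ∀ r, r ≠ a → r ≠ b → S₁ r = S r := by
  obtain ⟨st₁, hex₁, S₁, rfl, h⟩ : ∃ st₁, Exec w O (block [(.add, .dir a, .dir 51, .imm 0),
      (.add, .dir b, .dir 52, .imm 0)]) ⟨merge S H, qs⟩ st₁ 2 ∧ ∃ S₁, st₁ = ⟨merge S₁ H, qs⟩ ∧
      (S₁ a = mid ∧ S₁ b = hi ∧ ∀ r, r ≠ a → r ≠ b → S₁ r = S r) := by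
    refine Exec.block_of_fwd _ _ fun R hR => ?_
    have htmp := execOps_cons_fwd hR; clear hR; obtain ⟨v1, hv1, hR⟩ := htmp
    simp -failIfUnchanged (disch := omega) only [Operand.write, Operand.read, merge_apply_of_lt,
        merge_apply_of_le, Function.update_self, Function.update_of_ne, update_merge_of_lt,
        update_merge_of_le, Nat.add_zero, BinOp.eval_mod, BinOp.eval_eq, BinOp.eval_band,
        BinOp.eval_shr, BinOp.eval_div, BinOp.eval_lt, BinOp.eval_add_of_lt, BinOp.eval_sub_of_le,
        BinOp.eval_mul_of_lt, h51, h52] at hv1 hR; subst hv1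
    have htmp := execOps_cons_fwd hR; clear hR; obtain ⟨v2, hv2, hR⟩ := htmp
    simp -failIfUnchanged (disch := omega) only [Operand.write, Operand.read, merge_apply_of_lt,
        merge_apply_of_le, Function.update_self, Function.update_of_ne, update_merge_of_lt,
        update_merge_of_le, Nat.add_zero, BinOp.eval_mod, BinOp.eval_eq, BinOp.eval_band,
        BinOp.eval_shr, BinOp.eval_div, BinOp.eval_lt, BinOp.eval_add_of_lt, BinOp.eval_sub_of_le,
        BinOp.eval_mul_of_lt, h51, h52] at hv2 hR; subst hv2
    simp only [execOps_nil] at hR; subst hR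
    refine ⟨_, rfl, ?_, ?_, fun r h1 h2 => ?_⟩
    · rw [Function.update_of_ne hab, Function.update_self]
    · rw [Function.update_self]
    · rw [Function.update_of_ne h2, Function.update_of_ne h1]
  exact ⟨S₁, hex₁, h⟩

set_option linter.unusedSimpArgs false in
/-- The width test `r50 := hi - lo - 1` of the window registers `a`, `b`. [folklore] -/
theorem width_spec {S H : ℕ → ℕ} {qs : List (List ℕ)} {a b lo hi : ℕ} (ha : a < 100) (hb : b < 100)
    (hSa : S a = lo) (hSb : S b = hi) (hlh : lo < hi) (hw : hi < 2 ^ w) :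
    ∃ S₁, Exec w O (block [(.sub, .dir 50, .dir b, .dir a), (.sub, .dir 50, .dir 50, .imm 1)])
        ⟨merge S H, qs⟩ ⟨merge S₁ H, qs⟩ 2 ∧
      S₁ 50 = hi - lo - 1 ∧ ∀ r, r ≠ 50 → S₁ r = S r := by
  obtain ⟨st₁, hex₁, S₁, rfl, h⟩ : ∃ st₁, Exec w O (block [(.sub, .dir 50, .dir b, .dir a),
      (.sub, .dir 50, .dir 50, .imm 1)]) ⟨merge S H, qs⟩ st₁ 2 ∧ ∃ S₁, st₁ = ⟨merge S₁ H, qs⟩ ∧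
      (S₁ 50 = hi - lo - 1 ∧ ∀ r, r ≠ 50 → S₁ r = S r) := by
    refine Exec.block_of_fwd _ _ fun R hR => ?_
    have htmp := execOps_cons_fwd hR; clear hR; obtain ⟨v1, hv1, hR⟩ := htmp
    simp -failIfUnchanged (disch := omega) only [Operand.write, Operand.read, merge_apply_of_lt,
        merge_apply_of_le, Function.update_self, Function.update_of_ne, update_merge_of_lt,
        update_merge_of_le, Nat.add_zero, BinOp.eval_mod, BinOp.eval_eq, BinOp.eval_band,
        BinOp.eval_shr, BinOp.eval_div, BinOp.eval_lt, BinOp.eval_add_of_lt, BinOp.eval_sub_of_le,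
        BinOp.eval_mul_of_lt, hSa, hSb, merge_apply_of_lt ha, merge_apply_of_lt hb] at hv1 hR; subst hv1
    have htmp := execOps_cons_fwd hR; clear hR; obtain ⟨v2, hv2, hR⟩ := htmp
    simp -failIfUnchanged (disch := omega) only [Operand.write, Operand.read, merge_apply_of_lt,
        merge_apply_of_le, Function.update_self, Function.update_of_ne, update_merge_of_lt,
        update_merge_of_le, Nat.add_zero, BinOp.eval_mod, BinOp.eval_eq, BinOp.eval_band,
        BinOp.eval_shr, BinOp.eval_div, BinOp.eval_lt, BinOp.eval_add_of_lt, BinOp.eval_sub_of_le,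
        BinOp.eval_mul_of_lt, hSa, hSb, merge_apply_of_lt ha, merge_apply_of_lt hb] at hv2 hR; subst hv2
    simp only [execOps_nil] at hR; subst hR
    exact ⟨_, rfl, by rw [Function.update_self], fun r h1 => by rw [Function.update_of_ne h1, Function.update_of_ne h1]⟩
  exact ⟨S₁, hex₁, h⟩

/-- **The invariant of the row bisection**: the window `[rlo, rhi)` (width test `r50 = rhi - rlo - 1`)
contains the row of a witness pair of the block triple, the queries so far are well-formed instances,
and their number plus the remaining `size (rhi - rlo - 1)` halvings stays within the budget `N₀`. [folklore] -/
def RowInv (c' : ℕ) (X Y : Matrix (Fin n) (Fin n) (WithTop ℤ)) (lo fd : ℕ → ℕ) (M pw L pX pY F : ℕ)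
    (H₀ : ℕ → ℕ) (bi bj bk clo chi : ℕ) (qs₀ : List (List ℕ)) (N₀ : ℕ) (S₀ : ℕ → ℕ) (st : Store) : Prop :=
  ∃ (S H : ℕ → ℕ) (bs : List (NegativeTriangle c').Inst) (rlo rhi : ℕ),
    st = ⟨merge S H, qs₀ ++ bs.map (NegativeTriangle c').encode⟩ ∧
    KRegs n F pX pY M L (nblk n) pw S ∧ WRegs bi bj bk rlo rhi clo chi S ∧ S 50 = rhi - rlo - 1 ∧
    rlo < rhi ∧ rhi ≤ L ∧
    (∃ iu iv, iu < L ∧ clo ≤ iu ∧ iu < chi ∧ rlo ≤ iv ∧ iv < rhi ∧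
      (mkQ X Y lo fd M pw L bi bj bk).PairWit iu iv) ∧
    (∀ r, r < 45 → (r < 20 ∨ 40 ≤ r) → S r = S₀ r) ∧ DataQ (mkQ X Y lo fd M pw L bi bj bk) F H₀ H ∧
    bs.length + Nat.size (rhi - rlo - 1) ≤ N₀ ∧
    ∀ y ∈ bs, (NegativeTriangle c').size y = 3 * L ∧ ((NegativeTriangle c').encode y).length = 9 * (L * L) + 1

set_option linter.unusedSimpArgs false in
/-- **One row-bisection step**: query the lower half `[rlo, mid)`; keep it on a yes, move to
`[mid, rhi)` on a no (the witness row is then there); the potential `(tAsk L + 13) · size (rhi - rlo - 1)`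
pays for the step. [folklore] -/
theorem bisRowsBody_spec (hG : Geo n w F pX pY M) (hR : RFacts c' X Y lo M pw L pX pY H₀) {fd : ℕ → ℕ}
    (hfdb : ∀ t, t < n * n → fd t ≤ 8 * M + 2) (hO : (NegativeTriangle c').OracleAnswers O)
    {bi bj bk clo chi : ℕ} (hbi : bi < nblk n) (hbj : bj < nblk n) (hbk : bk < nblk n) (hchi : chi ≤ L)
    {qs₀ : List (List ℕ)} {N₀ : ℕ} {S₀ : ℕ → ℕ} {st : Store}
    (hst : RowInv c' X Y lo fd M pw L pX pY F H₀ bi bj bk clo chi qs₀ N₀ S₀ st)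
    (hne : (Operand.dir 50).read st.mem ≠ 0) :
    ∃ st' t, Exec w O bisRowsBody st st' t ∧ RowInv c' X Y lo fd M pw L pX pY F H₀ bi bj bk clo chi qs₀ N₀ S₀ st' ∧
      t + 2 + (tAsk L + 13) * Nat.size (st'.mem 46 - st'.mem 45 - 1) ≤
        (tAsk L + 13) * Nat.size (st.mem 46 - st.mem 45 - 1) := by
  obtain ⟨S, H, bs, rlo, rhi, rfl, hK, hW, h50, hlohi, hhiL, ⟨iu, iv, hiu, hclo, hiuc, hrlo, hivr, hwit⟩, hfr, hD,
    hbudget, hbs⟩ := hst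
  obtain ⟨hn, hpX, hpY, hpYF, hFw, hMw, hn3w⟩ := id hG
  have hLn : L ≤ n := hR.hL ▸ cubeRt_le n
  have hnn : n ≤ n * n := Nat.le_mul_self n
  have h50' : S 50 ≠ 0 := by rwa [show (Operand.dir 50).read (merge S H) = S 50 from merge_apply_of_lt (by norm_num)] at hne
  have h2 : rlo + 2 ≤ rhi := by rw [h50] at h50'; omega
  obtain ⟨mid, hmid⟩ : ∃ mid, mid = (rlo + rhi) / 2 := ⟨_, rfl⟩
  have hmid1 : rlo < mid := by omega
  have hmid2 : mid < rhi := by omega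
  obtain ⟨h42, h43, h44, h45, h46, h47, h48⟩ := id hW
  -- block 1: `mid`, save `rhi`, `rhi := mid`
  obtain ⟨S₁, hex₁, h51, h52, h46₁, hS₁⟩ := bisStep1_spec (w := w) (O := O) (H := H)
    (qs := qs₀ ++ bs.map (NegativeTriangle c').encode) (a := 45) (b := 46) (by norm_num) (by norm_num)
    (by norm_num) h45 h46 (by omega)
  rw [← hmid] at h51 h46₁
  have hK₁ : KRegs n F pX pY M L (nblk n) pw S₁ := hK.of_agree fun r hr => hS₁ r (by omega) (by omega) (by omega)
  have hW₁ : WRegs bi bj bk rlo mid clo chi S₁ :=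
    ⟨(hS₁ 42 (by omega) (by omega) (by omega)).trans h42, (hS₁ 43 (by omega) (by omega) (by omega)).trans h43,
      (hS₁ 44 (by omega) (by omega) (by omega)).trans h44, (hS₁ 45 (by omega) (by omega) (by omega)).trans h45,
      h46₁, (hS₁ 47 (by omega) (by omega) (by omega)).trans h47, (hS₁ 48 (by omega) (by omega) (by omega)).trans h48⟩
  -- the query on the lower half
  set q' : QData n := (mkQ X Y lo fd M pw L bi bj bk).setWin rlo mid clo chi with hq'
  have hQ' : QFacts c' q' pX pY H₀ := hR.qfacts fd hbi hbj hbk (by omega) hchi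
  have hK₁' : KRegs n F pX pY q'.M q'.L (nblk n) q'.pw S₁ := hK₁
  have hW₁' : WRegs q'.bi q'.bj q'.bk q'.rlo q'.rhi q'.clo q'.chi S₁ := hW₁
  have hD' : DataQ q' F H₀ H := hD.setWin _ _ _ _
  obtain ⟨S₂, H₂, ⟨t₂, ht₂', hex₂⟩, hK₂', hW₂', h49, hfr₂, hD₂⟩ := ask_spec (qs := qs₀ ++ bs.map (NegativeTriangle c').encode)
    hG hQ' hfdb hO hK₁' hW₁' hD'
  have ht₂ : t₂ ≤ tAsk L := ht₂'
  have hK₂ : KRegs n F pX pY M L (nblk n) pw S₂ := hK₂'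
  have hW₂ : WRegs bi bj bk rlo mid clo chi S₂ := hW₂'
  clear ht₂' hK₂' hW₂'
  have hD₂' : DataQ (mkQ X Y lo fd M pw L bi bj bk) F H₀ H₂ := ⟨hD₂.below, hD₂.lo, hD₂.fd, hD₂.zero⟩
  obtain ⟨h42₂, h43₂, h44₂, h45₂, h46₂, h47₂, h48₂⟩ := id hW₂
  have h51₂ : S₂ 51 = mid := (hfr₂ 51 (by omega) (by omega) (by omega)).trans h51
  have h52₂ : S₂ 52 = rhi := (hfr₂ 52 (by omega) (by omega) (by omega)).trans h52
  have hbs' : ∀ y ∈ bs ++ [hQ'.ok.inst], (NegativeTriangle c').size y = 3 * L ∧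
      ((NegativeTriangle c').encode y).length = 9 * (L * L) + 1 := by
    intro y hy
    rcases List.mem_append.1 hy with hy | hy
    · exact hbs y hy
    · rw [List.mem_singleton.1 hy]; exact ⟨hQ'.ok.size_inst, hQ'.ok.length_encode_inst⟩
  have hqs : qs₀ ++ bs.map (NegativeTriangle c').encode ++ [(NegativeTriangle c').encode hQ'.ok.inst] =
      qs₀ ++ (bs ++ [hQ'.ok.inst]).map (NegativeTriangle c').encode := by simp
  rw [hqs] at hex₂
  have hwit' : (q'.setWin rlo mid clo chi).Witness ↔ ∃ iu iv, iu < L ∧ iv < L ∧ rlo ≤ iv ∧ iv < mid ∧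
      clo ≤ iu ∧ iu < chi ∧ (mkQ X Y lo fd M pw L bi bj bk).PairWit iu iv := QData.witness_setWin_iff _ _ _ _ _
  have hqq : q'.setWin rlo mid clo chi = q' := rfl
  rw [hqq] at hwit'
  by_cases hans : ansOf q' = 0
  · -- no witness below `mid`: the witness row lies in `[mid, rhi)`
    have hivm : mid ≤ iv := by
      by_contra hlt
      have : q'.Witness := hwit'.2 ⟨iu, iv, hiu, by omega, hrlo, by omega, hclo, hiuc, hwit⟩
      exact ((ansOf_ne_zero_iff q').2 this) hans
    have h49' : (Operand.dir 49).read (merge S₂ H₂) = 0 := by rw [Operand.read_dir_merge (by norm_num), h49, hans]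
    obtain ⟨S₃, hex₃, h45₃, h46₃, hS₃⟩ := bisStep2_spec (w := w) (O := O) (H := H₂)
      (qs := qs₀ ++ (bs ++ [hQ'.ok.inst]).map (NegativeTriangle c').encode) (a := 45) (b := 46) (by norm_num)
      (by norm_num) (by norm_num) (by norm_num) (by norm_num) h51₂ h52₂ (by omega) (by omega)
    obtain ⟨S₄, hex₄, h50₄, hS₄⟩ := width_spec (w := w) (O := O) (H := H₂)
      (qs := qs₀ ++ (bs ++ [hQ'.ok.inst]).map (NegativeTriangle c').encode) (a := 45) (b := 46) (by norm_num)
      (by norm_num) h45₃ h46₃ hmid2 (by omega)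
    refine ⟨_, _, hex₁.seqs_cons (hex₂.seqs_cons ((Exec.ifz_zero h49' hex₃).seqs_cons (Exec.seqs_one hex₄))),
      ⟨S₄, H₂, bs ++ [hQ'.ok.inst], mid, rhi, rfl, ?_, ?_, h50₄, hmid2, hhiL, ⟨iu, iv, hiu, hclo, hiuc, hivm, hivr, hwit⟩,
        fun r hr hr' => ?_, hD₂', ?_, hbs'⟩, ?_⟩
    · exact (hK₂.of_agree fun r hr => hS₃ r (by omega) (by omega)).of_agree fun r hr => hS₄ r (by omega)
    · exact ⟨((hS₄ 42 (by omega)).trans (hS₃ 42 (by omega) (by omega))).trans h42₂,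
        ((hS₄ 43 (by omega)).trans (hS₃ 43 (by omega) (by omega))).trans h43₂,
        ((hS₄ 44 (by omega)).trans (hS₃ 44 (by omega) (by omega))).trans h44₂,
        (hS₄ 45 (by omega)).trans h45₃, (hS₄ 46 (by omega)).trans h46₃,
        ((hS₄ 47 (by omega)).trans (hS₃ 47 (by omega) (by omega))).trans h47₂,
        ((hS₄ 48 (by omega)).trans (hS₃ 48 (by omega) (by omega))).trans h48₂⟩
    · rw [hS₄ r (by omega), hS₃ r (by omega) (by omega), hfr₂ r (by omega) (by omega) (by omega),
        hS₁ r (by omega) (by omega) (by omega), hfr r hr hr']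
    · have := size_half_lt h2 (lo' := mid) (hi' := rhi) (Or.inr ⟨hmid, rfl⟩)
      rw [List.length_append, List.length_singleton]; omega
    · show 4 + (t₂ + ((2 + 1) + 2)) + 2 + (tAsk L + 13) * Nat.size (merge S₄ H₂ 46 - merge S₄ H₂ 45 - 1) ≤
        (tAsk L + 13) * Nat.size (merge S H 46 - merge S H 45 - 1)
      rw [merge_apply_of_lt (by norm_num), merge_apply_of_lt (by norm_num), merge_apply_of_lt (by norm_num),
        merge_apply_of_lt (by norm_num), (hS₄ 46 (by omega)).trans h46₃, (hS₄ 45 (by omega)).trans h45₃, h46, h45]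
      have := size_half_lt h2 (lo' := mid) (hi' := rhi) (Or.inr ⟨hmid, rfl⟩)
      have hsz : Nat.size (rhi - mid - 1) + 1 ≤ Nat.size (rhi - rlo - 1) := this
      have hA : (tAsk L + 13) * Nat.size (rhi - mid - 1) + (tAsk L + 13) ≤ (tAsk L + 13) * Nat.size (rhi - rlo - 1) := by
        rw [← Nat.mul_succ]; exact Nat.mul_le_mul_left _ hsz
      omega
  · -- a witness below `mid`: keep `[rlo, mid)`
    have hw' : ∃ iu iv, iu < L ∧ clo ≤ iu ∧ iu < chi ∧ rlo ≤ iv ∧ iv < mid ∧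
        (mkQ X Y lo fd M pw L bi bj bk).PairWit iu iv := by
      obtain ⟨iu', iv', hiu', -, h1, h2, h3, h4, hw⟩ := hwit'.1 ((ansOf_ne_zero_iff q').1 hans)
      exact ⟨iu', iv', hiu', h3, h4, h1, h2, hw⟩
    have h49' : (Operand.dir 49).read (merge S₂ H₂) ≠ 0 := by rw [Operand.read_dir_merge (by norm_num), h49]; exact hans
    obtain ⟨S₄, hex₄, h50₄, hS₄⟩ := width_spec (w := w) (O := O) (H := H₂)
      (qs := qs₀ ++ (bs ++ [hQ'.ok.inst]).map (NegativeTriangle c').encode) (a := 45) (b := 46) (by norm_num)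
      (by norm_num) h45₂ h46₂ hmid1 (by omega)
    refine ⟨_, _, hex₁.seqs_cons (hex₂.seqs_cons ((Exec.ifz_ne h49' (Exec.skip _)).seqs_cons (Exec.seqs_one hex₄))),
      ⟨S₄, H₂, bs ++ [hQ'.ok.inst], rlo, mid, rfl, hK₂.of_agree fun r hr => hS₄ r (by omega), ?_, h50₄, hmid1,
        by omega, hw', fun r hr hr' => ?_, hD₂', ?_, hbs'⟩, ?_⟩
    · exact ⟨(hS₄ 42 (by omega)).trans h42₂, (hS₄ 43 (by omega)).trans h43₂, (hS₄ 44 (by omega)).trans h44₂,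
        (hS₄ 45 (by omega)).trans h45₂, (hS₄ 46 (by omega)).trans h46₂, (hS₄ 47 (by omega)).trans h47₂,
        (hS₄ 48 (by omega)).trans h48₂⟩
    · rw [hS₄ r (by omega), hfr₂ r (by omega) (by omega) (by omega), hS₁ r (by omega) (by omega) (by omega), hfr r hr hr']
    · have := size_half_lt h2 (lo' := rlo) (hi' := mid) (Or.inl ⟨rfl, hmid⟩)
      rw [List.length_append, List.length_singleton]; omega
    · show 4 + (t₂ + ((0 + 2) + 2)) + 2 + (tAsk L + 13) * Nat.size (merge S₄ H₂ 46 - merge S₄ H₂ 45 - 1) ≤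
        (tAsk L + 13) * Nat.size (merge S H 46 - merge S H 45 - 1)
      rw [merge_apply_of_lt (by norm_num), merge_apply_of_lt (by norm_num), merge_apply_of_lt (by norm_num),
        merge_apply_of_lt (by norm_num), (hS₄ 46 (by omega)).trans h46₂, (hS₄ 45 (by omega)).trans h45₂, h46, h45]
      have := size_half_lt h2 (lo' := rlo) (hi' := mid) (Or.inl ⟨rfl, hmid⟩)
      have hsz : Nat.size (mid - rlo - 1) + 1 ≤ Nat.size (rhi - rlo - 1) := this
      have hA : (tAsk L + 13) * Nat.size (mid - rlo - 1) + (tAsk L + 13) ≤ (tAsk L + 13) * Nat.size (rhi - rlo - 1) := by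
        rw [← Nat.mul_succ]; exact Nat.mul_le_mul_left _ hsz
      omega

/-- **Row bisection.** From the registers of a block triple with full row window `[0, L)` and a
column window `[clo, chi)` containing a witness pair, `bisRows` ends with a one-row window
`[i, i + 1)` containing a witness pair, after at most `size (L - 1)` well-formed queries, within
`(tAsk L + 13) · size (L - 1) + 3` steps. [folklore] -/
theorem bisRows_spec (hG : Geo n w F pX pY M) (hR : RFacts c' X Y lo M pw L pX pY H₀) {fd : ℕ → ℕ}
    (hfdb : ∀ t, t < n * n → fd t ≤ 8 * M + 2) (hO : (NegativeTriangle c').OracleAnswers O)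
    {bi bj bk clo chi : ℕ} (hbi : bi < nblk n) (hbj : bj < nblk n) (hbk : bk < nblk n) (hchi : chi ≤ L)
    {S H : ℕ → ℕ} {qs₀ : List (List ℕ)} (hK : KRegs n F pX pY M L (nblk n) pw S) (hW : WRegs bi bj bk 0 L clo chi S)
    (hD : DataQ (mkQ X Y lo fd M pw L bi bj bk) F H₀ H)
    (hwit : ∃ iu iv, iu < L ∧ iv < L ∧ clo ≤ iu ∧ iu < chi ∧ (mkQ X Y lo fd M pw L bi bj bk).PairWit iu iv) :
    ∃ (S' H' : ℕ → ℕ) (bs : List (NegativeTriangle c').Inst) (i : ℕ),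
      ExecLE w O bisRows ⟨merge S H, qs₀⟩ ⟨merge S' H', qs₀ ++ bs.map (NegativeTriangle c').encode⟩
        ((tAsk L + 13) * Nat.size (L - 1) + 3) ∧
      KRegs n F pX pY M L (nblk n) pw S' ∧ WRegs bi bj bk i (i + 1) clo chi S' ∧ i < L ∧
      (∃ iu, iu < L ∧ clo ≤ iu ∧ iu < chi ∧ (mkQ X Y lo fd M pw L bi bj bk).PairWit iu i) ∧
      (∀ r, r < 45 → (r < 20 ∨ 40 ≤ r) → S' r = S r) ∧ DataQ (mkQ X Y lo fd M pw L bi bj bk) F H₀ H' ∧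
      bs.length ≤ Nat.size (L - 1) ∧
      ∀ y ∈ bs, (NegativeTriangle c').size y = 3 * L ∧ ((NegativeTriangle c').encode y).length = 9 * (L * L) + 1 := by
  obtain ⟨hn, hpX, hpY, hpYF, hFw, hMw, hn3w⟩ := id hG
  have hLn : L ≤ n := hR.hL ▸ cubeRt_le n
  have hnn : n ≤ n * n := Nat.le_mul_self n
  obtain ⟨h42, h43, h44, h45, h46, h47, h48⟩ := id hW
  obtain ⟨iu, iv, hiu, hiv, hclo, hiuc, hw⟩ := hwit
  -- the width test
  obtain ⟨S₁, hex₁, h50, hS₁⟩ := width_spec (w := w) (O := O) (H := H) (qs := qs₀) (a := 45) (b := 46)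
    (by norm_num) (by norm_num) h45 h46 (by omega) (by omega)
  have hinv : RowInv c' X Y lo fd M pw L pX pY F H₀ bi bj bk clo chi qs₀ (Nat.size (L - 1)) S
      ⟨merge S₁ H, qs₀⟩ :=
    ⟨S₁, H, [], 0, L, by simp, hK.of_agree fun r hr => hS₁ r (by omega), hW.of_agree fun r hr _ => hS₁ r (by omega),
      by rw [h50], by omega, le_rfl, ⟨iu, iv, hiu, hclo, hiuc, Nat.zero_le _, hiv, hw⟩, fun r hr hr' => hS₁ r (by omega), hD,
      by simp, fun y hy => by simp at hy⟩
  obtain ⟨st', hloop, hinv', hexit⟩ := ExecLE.whilenz_potential (w := w) (O := O) (x := .dir 50) (s := bisRowsBody)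
    (RowInv c' X Y lo fd M pw L pX pY F H₀ bi bj bk clo chi qs₀ (Nat.size (L - 1)) S)
    (fun st => (tAsk L + 13) * Nat.size (st.mem 46 - st.mem 45 - 1))
    (fun st hst hne => bisRowsBody_spec hG hR hfdb hO hbi hbj hbk hchi hst hne) hinv
  obtain ⟨S', H', bs, rlo, rhi, rfl, hK', hW', h50', hlohi, hhiL, ⟨iu', iv', hiu', hclo', hiuc', hrlo', hivr', hw'⟩,
    hfr, hD', hbudget, hbs⟩ := hinv'
  have h50'' : S' 50 = 0 := by rwa [show (Operand.dir 50).read (merge S' H') = S' 50 from merge_apply_of_lt (by norm_num)] at hexit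
  have hrhi : rhi = rlo + 1 := by rw [h50'] at h50''; omega
  have hiv' : iv' = rlo := by omega
  subst hiv'
  refine ⟨S', H', bs, iv', hex₁.execLE.seq (hloop.mono (show _ ≤ (tAsk L + 13) * Nat.size (L - 1) + 1 from ?_))
    |>.mono (by omega), hK', hrhi ▸ hW', by omega, ⟨iu', hiu', hclo', hiuc', hw'⟩, fun r hr hr' => hfr r hr hr', hD',
    by omega, hbs⟩
  show (tAsk L + 13) * Nat.size (merge S₁ H 46 - merge S₁ H 45 - 1) + 1 ≤ (tAsk L + 13) * Nat.size (L - 1) + 1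
  rw [merge_apply_of_lt (by norm_num), merge_apply_of_lt (by norm_num), (hS₁ 46 (by omega)).trans h46,
    (hS₁ 45 (by omega)).trans h45, Nat.sub_zero]


/-- **The invariant of the column bisection**: the row `i` being fixed, the window `[clo, chi)`
(width test `r50 = chi - clo - 1`) contains the column of a witness pair in row `i`, the queries so far are well-formed instances,
and their number plus the remaining `size (chi - clo - 1)` halvings stays within the budget `N₀`. [folklore] -/
def ColInv (c' : ℕ) (X Y : Matrix (Fin n) (Fin n) (WithTop ℤ)) (lo fd : ℕ → ℕ) (M pw L pX pY F : ℕ)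
    (H₀ : ℕ → ℕ) (bi bj bk i : ℕ) (qs₀ : List (List ℕ)) (N₀ : ℕ) (S₀ : ℕ → ℕ) (st : Store) : Prop :=
  ∃ (S H : ℕ → ℕ) (bs : List (NegativeTriangle c').Inst) (clo chi : ℕ),
    st = ⟨merge S H, qs₀ ++ bs.map (NegativeTriangle c').encode⟩ ∧
    KRegs n F pX pY M L (nblk n) pw S ∧ WRegs bi bj bk i (i + 1) clo chi S ∧ S 50 = chi - clo - 1 ∧
    clo < chi ∧ chi ≤ L ∧
    (∃ iu, clo ≤ iu ∧ iu < chi ∧ (mkQ X Y lo fd M pw L bi bj bk).PairWit iu i) ∧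
    (∀ r, r < 45 → (r < 20 ∨ 40 ≤ r) → S r = S₀ r) ∧ DataQ (mkQ X Y lo fd M pw L bi bj bk) F H₀ H ∧
    bs.length + Nat.size (chi - clo - 1) ≤ N₀ ∧
    ∀ y ∈ bs, (NegativeTriangle c').size y = 3 * L ∧ ((NegativeTriangle c').encode y).length = 9 * (L * L) + 1

set_option linter.unusedSimpArgs false in
/-- **One column-bisection step**: query the lower half `[clo, mid)` of the column window in the
fixed row; keep it on a yes, move to `[mid, chi)` on a no; the potential
`(tAsk L + 13) · size (chi - clo - 1)` pays for the step. [folklore] -/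
theorem bisColsBody_spec (hG : Geo n w F pX pY M) (hR : RFacts c' X Y lo M pw L pX pY H₀) {fd : ℕ → ℕ}
    (hfdb : ∀ t, t < n * n → fd t ≤ 8 * M + 2) (hO : (NegativeTriangle c').OracleAnswers O)
    {bi bj bk i : ℕ} (hbi : bi < nblk n) (hbj : bj < nblk n) (hbk : bk < nblk n) (hi : i < L)
    {qs₀ : List (List ℕ)} {N₀ : ℕ} {S₀ : ℕ → ℕ} {st : Store}
    (hst : ColInv c' X Y lo fd M pw L pX pY F H₀ bi bj bk i qs₀ N₀ S₀ st)
    (hne : (Operand.dir 50).read st.mem ≠ 0) :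
    ∃ st' t, Exec w O bisColsBody st st' t ∧ ColInv c' X Y lo fd M pw L pX pY F H₀ bi bj bk i qs₀ N₀ S₀ st' ∧
      t + 2 + (tAsk L + 13) * Nat.size (st'.mem 48 - st'.mem 47 - 1) ≤
        (tAsk L + 13) * Nat.size (st.mem 48 - st.mem 47 - 1) := by
  obtain ⟨S, H, bs, rlo, rhi, rfl, hK, hW, h50, hlohi, hhiL, ⟨iu, hrlo, hivr, hwit⟩, hfr, hD,
    hbudget, hbs⟩ := hst
  obtain ⟨hn, hpX, hpY, hpYF, hFw, hMw, hn3w⟩ := id hG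
  have hLn : L ≤ n := hR.hL ▸ cubeRt_le n
  have hnn : n ≤ n * n := Nat.le_mul_self n
  have h50' : S 50 ≠ 0 := by rwa [show (Operand.dir 50).read (merge S H) = S 50 from merge_apply_of_lt (by norm_num)] at hne
  have h2 : rlo + 2 ≤ rhi := by rw [h50] at h50'; omega
  obtain ⟨mid, hmid⟩ : ∃ mid, mid = (rlo + rhi) / 2 := ⟨_, rfl⟩
  have hmid1 : rlo < mid := by omega
  have hmid2 : mid < rhi := by omega
  obtain ⟨h42, h43, h44, h45, h46, h47, h48⟩ := id hW
  -- block 1: `mid`, save `chi`, `chi := mid`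
  obtain ⟨S₁, hex₁, h51, h52, h48₁, hS₁⟩ := bisStep1_spec (w := w) (O := O) (H := H)
    (qs := qs₀ ++ bs.map (NegativeTriangle c').encode) (a := 47) (b := 48) (by norm_num) (by norm_num)
    (by norm_num) h47 h48 (by omega)
  rw [← hmid] at h51 h48₁
  have hK₁ : KRegs n F pX pY M L (nblk n) pw S₁ := hK.of_agree fun r hr => hS₁ r (by omega) (by omega) (by omega)
  have hW₁ : WRegs bi bj bk i (i + 1) rlo mid S₁ :=
    ⟨(hS₁ 42 (by omega) (by omega) (by omega)).trans h42, (hS₁ 43 (by omega) (by omega) (by omega)).trans h43,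
      (hS₁ 44 (by omega) (by omega) (by omega)).trans h44, (hS₁ 45 (by omega) (by omega) (by omega)).trans h45,
      (hS₁ 46 (by omega) (by omega) (by omega)).trans h46, (hS₁ 47 (by omega) (by omega) (by omega)).trans h47, h48₁⟩
  -- the query on the lower half
  set q' : QData n := (mkQ X Y lo fd M pw L bi bj bk).setWin i (i + 1) rlo mid with hq'
  have hQ' : QFacts c' q' pX pY H₀ := hR.qfacts fd hbi hbj hbk (by omega) (by omega)
  have hK₁' : KRegs n F pX pY q'.M q'.L (nblk n) q'.pw S₁ := hK₁
  have hW₁' : WRegs q'.bi q'.bj q'.bk q'.rlo q'.rhi q'.clo q'.chi S₁ := hW₁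
  have hD' : DataQ q' F H₀ H := hD.setWin _ _ _ _
  obtain ⟨S₂, H₂, ⟨t₂, ht₂', hex₂⟩, hK₂', hW₂', h49, hfr₂, hD₂⟩ := ask_spec (qs := qs₀ ++ bs.map (NegativeTriangle c').encode)
    hG hQ' hfdb hO hK₁' hW₁' hD'
  have ht₂ : t₂ ≤ tAsk L := ht₂'
  have hK₂ : KRegs n F pX pY M L (nblk n) pw S₂ := hK₂'
  have hW₂ : WRegs bi bj bk i (i + 1) rlo mid S₂ := hW₂'
  clear ht₂' hK₂' hW₂'
  have hD₂' : DataQ (mkQ X Y lo fd M pw L bi bj bk) F H₀ H₂ := ⟨hD₂.below, hD₂.lo, hD₂.fd, hD₂.zero⟩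
  obtain ⟨h42₂, h43₂, h44₂, h45₂, h46₂, h47₂, h48₂⟩ := id hW₂
  have h51₂ : S₂ 51 = mid := (hfr₂ 51 (by omega) (by omega) (by omega)).trans h51
  have h52₂ : S₂ 52 = rhi := (hfr₂ 52 (by omega) (by omega) (by omega)).trans h52
  have hbs' : ∀ y ∈ bs ++ [hQ'.ok.inst], (NegativeTriangle c').size y = 3 * L ∧
      ((NegativeTriangle c').encode y).length = 9 * (L * L) + 1 := by
    intro y hy
    rcases List.mem_append.1 hy with hy | hy
    · exact hbs y hy
    · rw [List.mem_singleton.1 hy]; exact ⟨hQ'.ok.size_inst, hQ'.ok.length_encode_inst⟩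
  have hqs : qs₀ ++ bs.map (NegativeTriangle c').encode ++ [(NegativeTriangle c').encode hQ'.ok.inst] =
      qs₀ ++ (bs ++ [hQ'.ok.inst]).map (NegativeTriangle c').encode := by simp
  rw [hqs] at hex₂
  have hwit' : (q'.setWin i (i + 1) rlo mid).Witness ↔ ∃ iu iv, iu < L ∧ iv < L ∧ i ≤ iv ∧ iv < i + 1 ∧
      rlo ≤ iu ∧ iu < mid ∧ (mkQ X Y lo fd M pw L bi bj bk).PairWit iu iv := QData.witness_setWin_iff _ _ _ _ _
  have hqq : q'.setWin i (i + 1) rlo mid = q' := rfl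
  rw [hqq] at hwit'
  by_cases hans : ansOf q' = 0
  · -- no witness below `mid`: the witness column lies in `[mid, chi)`
    have hivm : mid ≤ iu := by
      by_contra hlt
      have : q'.Witness := hwit'.2 ⟨iu, i, by omega, hi, le_rfl, Nat.lt_succ_self i, hrlo, by omega, hwit⟩
      exact ((ansOf_ne_zero_iff q').2 this) hans
    have h49' : (Operand.dir 49).read (merge S₂ H₂) = 0 := by rw [Operand.read_dir_merge (by norm_num), h49, hans]
    obtain ⟨S₃, hex₃, h47₃, h48₃, hS₃⟩ := bisStep2_spec (w := w) (O := O) (H := H₂)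
      (qs := qs₀ ++ (bs ++ [hQ'.ok.inst]).map (NegativeTriangle c').encode) (a := 47) (b := 48) (by norm_num)
      (by norm_num) (by norm_num) (by norm_num) (by norm_num) h51₂ h52₂ (by omega) (by omega)
    obtain ⟨S₄, hex₄, h50₄, hS₄⟩ := width_spec (w := w) (O := O) (H := H₂)
      (qs := qs₀ ++ (bs ++ [hQ'.ok.inst]).map (NegativeTriangle c').encode) (a := 47) (b := 48) (by norm_num)
      (by norm_num) h47₃ h48₃ hmid2 (by omega)
    refine ⟨_, _, hex₁.seqs_cons (hex₂.seqs_cons ((Exec.ifz_zero h49' hex₃).seqs_cons (Exec.seqs_one hex₄))),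
      ⟨S₄, H₂, bs ++ [hQ'.ok.inst], mid, rhi, rfl, ?_, ?_, h50₄, hmid2, hhiL, ⟨iu, hivm, hivr, hwit⟩,
        fun r hr hr' => ?_, hD₂', ?_, hbs'⟩, ?_⟩
    · exact (hK₂.of_agree fun r hr => hS₃ r (by omega) (by omega)).of_agree fun r hr => hS₄ r (by omega)
    · exact ⟨((hS₄ 42 (by omega)).trans (hS₃ 42 (by omega) (by omega))).trans h42₂,
        ((hS₄ 43 (by omega)).trans (hS₃ 43 (by omega) (by omega))).trans h43₂,
        ((hS₄ 44 (by omega)).trans (hS₃ 44 (by omega) (by omega))).trans h44₂,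
        ((hS₄ 45 (by omega)).trans (hS₃ 45 (by omega) (by omega))).trans h45₂,
        ((hS₄ 46 (by omega)).trans (hS₃ 46 (by omega) (by omega))).trans h46₂,
        (hS₄ 47 (by omega)).trans h47₃, (hS₄ 48 (by omega)).trans h48₃⟩
    · rw [hS₄ r (by omega), hS₃ r (by omega) (by omega), hfr₂ r (by omega) (by omega) (by omega),
        hS₁ r (by omega) (by omega) (by omega), hfr r hr hr']
    · have := size_half_lt h2 (lo' := mid) (hi' := rhi) (Or.inr ⟨hmid, rfl⟩)
      rw [List.length_append, List.length_singleton]; omega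
    · show 4 + (t₂ + ((2 + 1) + 2)) + 2 + (tAsk L + 13) * Nat.size (merge S₄ H₂ 48 - merge S₄ H₂ 47 - 1) ≤
        (tAsk L + 13) * Nat.size (merge S H 48 - merge S H 47 - 1)
      rw [merge_apply_of_lt (by norm_num), merge_apply_of_lt (by norm_num), merge_apply_of_lt (by norm_num),
        merge_apply_of_lt (by norm_num), (hS₄ 48 (by omega)).trans h48₃, (hS₄ 47 (by omega)).trans h47₃, h48, h47]
      have := size_half_lt h2 (lo' := mid) (hi' := rhi) (Or.inr ⟨hmid, rfl⟩)
      have hsz : Nat.size (rhi - mid - 1) + 1 ≤ Nat.size (rhi - rlo - 1) := this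
      have hA : (tAsk L + 13) * Nat.size (rhi - mid - 1) + (tAsk L + 13) ≤ (tAsk L + 13) * Nat.size (rhi - rlo - 1) := by
        rw [← Nat.mul_succ]; exact Nat.mul_le_mul_left _ hsz
      omega
  · -- a witness below `mid`: keep `[clo, mid)`
    have hw' : ∃ iu, rlo ≤ iu ∧ iu < mid ∧ (mkQ X Y lo fd M pw L bi bj bk).PairWit iu i := by
      obtain ⟨iu', iv', -, -, h1, h2, h3, h4, hw⟩ := hwit'.1 ((ansOf_ne_zero_iff q').1 hans)
      obtain rfl : iv' = i := by omega
      exact ⟨iu', h3, h4, hw⟩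
    have h49' : (Operand.dir 49).read (merge S₂ H₂) ≠ 0 := by rw [Operand.read_dir_merge (by norm_num), h49]; exact hans
    obtain ⟨S₄, hex₄, h50₄, hS₄⟩ := width_spec (w := w) (O := O) (H := H₂)
      (qs := qs₀ ++ (bs ++ [hQ'.ok.inst]).map (NegativeTriangle c').encode) (a := 47) (b := 48) (by norm_num)
      (by norm_num) h47₂ h48₂ hmid1 (by omega)
    refine ⟨_, _, hex₁.seqs_cons (hex₂.seqs_cons ((Exec.ifz_ne h49' (Exec.skip _)).seqs_cons (Exec.seqs_one hex₄))),
      ⟨S₄, H₂, bs ++ [hQ'.ok.inst], rlo, mid, rfl, hK₂.of_agree fun r hr => hS₄ r (by omega), ?_, h50₄, hmid1,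
        by omega, hw', fun r hr hr' => ?_, hD₂', ?_, hbs'⟩, ?_⟩
    · exact ⟨(hS₄ 42 (by omega)).trans h42₂, (hS₄ 43 (by omega)).trans h43₂, (hS₄ 44 (by omega)).trans h44₂,
        (hS₄ 45 (by omega)).trans h45₂, (hS₄ 46 (by omega)).trans h46₂, (hS₄ 47 (by omega)).trans h47₂,
        (hS₄ 48 (by omega)).trans h48₂⟩
    · rw [hS₄ r (by omega), hfr₂ r (by omega) (by omega) (by omega), hS₁ r (by omega) (by omega) (by omega), hfr r hr hr']
    · have := size_half_lt h2 (lo' := rlo) (hi' := mid) (Or.inl ⟨rfl, hmid⟩)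
      rw [List.length_append, List.length_singleton]; omega
    · show 4 + (t₂ + ((0 + 2) + 2)) + 2 + (tAsk L + 13) * Nat.size (merge S₄ H₂ 48 - merge S₄ H₂ 47 - 1) ≤
        (tAsk L + 13) * Nat.size (merge S H 48 - merge S H 47 - 1)
      rw [merge_apply_of_lt (by norm_num), merge_apply_of_lt (by norm_num), merge_apply_of_lt (by norm_num),
        merge_apply_of_lt (by norm_num), (hS₄ 48 (by omega)).trans h48₂, (hS₄ 47 (by omega)).trans h47₂, h48, h47]
      have := size_half_lt h2 (lo' := rlo) (hi' := mid) (Or.inl ⟨rfl, hmid⟩)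
      have hsz : Nat.size (mid - rlo - 1) + 1 ≤ Nat.size (rhi - rlo - 1) := this
      have hA : (tAsk L + 13) * Nat.size (mid - rlo - 1) + (tAsk L + 13) ≤ (tAsk L + 13) * Nat.size (rhi - rlo - 1) := by
        rw [← Nat.mul_succ]; exact Nat.mul_le_mul_left _ hsz
      omega

/-- **Column bisection.** From a one-row window `[i, i + 1)` and the full column window `[0, L)`
containing a witness pair in row `i`, `bisCols` ends with a one-cell window `[j, j + 1)` on a witness
pair `(j, i)`, after at most `size (L - 1)` well-formed queries, within
`(tAsk L + 13) · size (L - 1) + 3` steps. [folklore] -/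
theorem bisCols_spec (hG : Geo n w F pX pY M) (hR : RFacts c' X Y lo M pw L pX pY H₀) {fd : ℕ → ℕ}
    (hfdb : ∀ t, t < n * n → fd t ≤ 8 * M + 2) (hO : (NegativeTriangle c').OracleAnswers O)
    {bi bj bk i : ℕ} (hbi : bi < nblk n) (hbj : bj < nblk n) (hbk : bk < nblk n) (hi : i < L)
    {S H : ℕ → ℕ} {qs₀ : List (List ℕ)} (hK : KRegs n F pX pY M L (nblk n) pw S) (hW : WRegs bi bj bk i (i + 1) 0 L S)
    (hD : DataQ (mkQ X Y lo fd M pw L bi bj bk) F H₀ H)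
    (hwit : ∃ iu, iu < L ∧ (mkQ X Y lo fd M pw L bi bj bk).PairWit iu i) :
    ∃ (S' H' : ℕ → ℕ) (bs : List (NegativeTriangle c').Inst) (j : ℕ),
      ExecLE w O bisCols ⟨merge S H, qs₀⟩ ⟨merge S' H', qs₀ ++ bs.map (NegativeTriangle c').encode⟩
        ((tAsk L + 13) * Nat.size (L - 1) + 3) ∧
      KRegs n F pX pY M L (nblk n) pw S' ∧ WRegs bi bj bk i (i + 1) j (j + 1) S' ∧ j < L ∧
      (mkQ X Y lo fd M pw L bi bj bk).PairWit j i ∧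
      (∀ r, r < 45 → (r < 20 ∨ 40 ≤ r) → S' r = S r) ∧ DataQ (mkQ X Y lo fd M pw L bi bj bk) F H₀ H' ∧
      bs.length ≤ Nat.size (L - 1) ∧
      ∀ y ∈ bs, (NegativeTriangle c').size y = 3 * L ∧ ((NegativeTriangle c').encode y).length = 9 * (L * L) + 1 := by
  obtain ⟨hn, hpX, hpY, hpYF, hFw, hMw, hn3w⟩ := id hG
  have hLn : L ≤ n := hR.hL ▸ cubeRt_le n
  have hnn : n ≤ n * n := Nat.le_mul_self n
  obtain ⟨h42, h43, h44, h45, h46, h47, h48⟩ := id hW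
  obtain ⟨iu, hiu, hw⟩ := hwit
  -- the width test
  obtain ⟨S₁, hex₁, h50, hS₁⟩ := width_spec (w := w) (O := O) (H := H) (qs := qs₀) (a := 47) (b := 48)
    (by norm_num) (by norm_num) h47 h48 (by omega) (by omega)
  have hinv : ColInv c' X Y lo fd M pw L pX pY F H₀ bi bj bk i qs₀ (Nat.size (L - 1)) S
      ⟨merge S₁ H, qs₀⟩ :=
    ⟨S₁, H, [], 0, L, by simp, hK.of_agree fun r hr => hS₁ r (by omega), hW.of_agree fun r hr _ => hS₁ r (by omega),
      by rw [h50], by omega, le_rfl, ⟨iu, Nat.zero_le _, hiu, hw⟩, fun r hr hr' => hS₁ r (by omega), hD,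
      by simp, fun y hy => by simp at hy⟩
  obtain ⟨st', hloop, hinv', hexit⟩ := ExecLE.whilenz_potential (w := w) (O := O) (x := .dir 50) (s := bisColsBody)
    (ColInv c' X Y lo fd M pw L pX pY F H₀ bi bj bk i qs₀ (Nat.size (L - 1)) S)
    (fun st => (tAsk L + 13) * Nat.size (st.mem 48 - st.mem 47 - 1))
    (fun st hst hne => bisColsBody_spec hG hR hfdb hO hbi hbj hbk hi hst hne) hinv
  obtain ⟨S', H', bs, rlo, rhi, rfl, hK', hW', h50', hlohi, hhiL, ⟨iu', hrlo', hivr', hw'⟩,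
    hfr, hD', hbudget, hbs⟩ := hinv'
  have h50'' : S' 50 = 0 := by rwa [show (Operand.dir 50).read (merge S' H') = S' 50 from merge_apply_of_lt (by norm_num)] at hexit
  have hrhi : rhi = rlo + 1 := by rw [h50'] at h50''; omega
  have hiu' : iu' = rlo := by omega
  subst hiu'
  refine ⟨S', H', bs, iu', hex₁.execLE.seq (hloop.mono (show _ ≤ (tAsk L + 13) * Nat.size (L - 1) + 1 from ?_))
    |>.mono (by omega), hK', hrhi ▸ hW', by omega, hw', fun r hr hr' => hfr r hr hr', hD',
    by omega, hbs⟩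
  show (tAsk L + 13) * Nat.size (merge S₁ H 48 - merge S₁ H 47 - 1) + 1 ≤ (tAsk L + 13) * Nat.size (L - 1) + 1
  rw [merge_apply_of_lt (by norm_num), merge_apply_of_lt (by norm_num), (hS₁ 48 (by omega)).trans h48,
    (hS₁ 47 (by omega)).trans h47, Nat.sub_zero]

end Bisect

/-! ## The search of one round -/

section Search

variable {w : ℕ} {O : List ℕ → List ℕ} {F : ℕ}

set_option linter.unusedSimpArgs false in
/-- **Setting up the current block triple** (`tripleOps`): `bi = tr / nb²`, `bj = tr / nb mod nb`,
`bk = tr mod nb`, full windows. [folklore] -/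
theorem triple_spec {S H : ℕ → ℕ} {qs : List (List ℕ)} {tr nb L : ℕ} (h25 : S 25 = L) (h28 : S 28 = nb)
    (h29 : S 29 = nb * nb) (h40 : S 40 = tr) (hL : L < 2 ^ w) :
    ∃ S₁, Exec w O (block tripleOps) ⟨merge S H, qs⟩ ⟨merge S₁ H, qs⟩ 8 ∧
      WRegs (tr / (nb * nb)) (tr / nb % nb) (tr % nb) 0 L 0 L S₁ ∧ ∀ r, r < 42 ∨ 48 < r → S₁ r = S r := by
  obtain ⟨st₁, hex₁, S₁, rfl, h⟩ : ∃ st₁, Exec w O (block tripleOps) ⟨merge S H, qs⟩ st₁ 8 ∧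
      ∃ S₁, st₁ = ⟨merge S₁ H, qs⟩ ∧ (WRegs (tr / (nb * nb)) (tr / nb % nb) (tr % nb) 0 L 0 L S₁ ∧
        ∀ r, r < 42 ∨ 48 < r → S₁ r = S r) := by
    refine Exec.block_of_fwd _ _ fun R hR => ?_
    unfold tripleOps at hR
    have htmp := execOps_cons_fwd hR; clear hR; obtain ⟨v1, hv1, hR⟩ := htmp
    simp -failIfUnchanged (disch := omega) only [Operand.write, Operand.read, merge_apply_of_lt,
        merge_apply_of_le, Function.update_self, Function.update_of_ne, update_merge_of_lt,
        update_merge_of_le, Nat.add_zero, BinOp.eval_mod, BinOp.eval_eq, BinOp.eval_band,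
        BinOp.eval_shr, BinOp.eval_div, BinOp.eval_lt, BinOp.eval_add_of_lt, BinOp.eval_sub_of_le,
        BinOp.eval_mul_of_lt, h25, h28, h29, h40] at hv1 hR; subst hv1
    have htmp := execOps_cons_fwd hR; clear hR; obtain ⟨v2, hv2, hR⟩ := htmp
    simp -failIfUnchanged (disch := omega) only [Operand.write, Operand.read, merge_apply_of_lt,
        merge_apply_of_le, Function.update_self, Function.update_of_ne, update_merge_of_lt,
        update_merge_of_le, Nat.add_zero, BinOp.eval_mod, BinOp.eval_eq, BinOp.eval_band,
        BinOp.eval_shr, BinOp.eval_div, BinOp.eval_lt, BinOp.eval_add_of_lt, BinOp.eval_sub_of_le,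
        BinOp.eval_mul_of_lt, h25, h28, h29, h40] at hv2 hR; subst hv2
    have htmp := execOps_cons_fwd hR; clear hR; obtain ⟨v3, hv3, hR⟩ := htmp
    simp -failIfUnchanged (disch := omega) only [Operand.write, Operand.read, merge_apply_of_lt,
        merge_apply_of_le, Function.update_self, Function.update_of_ne, update_merge_of_lt,
        update_merge_of_le, Nat.add_zero, BinOp.eval_mod, BinOp.eval_eq, BinOp.eval_band,
        BinOp.eval_shr, BinOp.eval_div, BinOp.eval_lt, BinOp.eval_add_of_lt, BinOp.eval_sub_of_le,
        BinOp.eval_mul_of_lt, h25, h28, h29, h40] at hv3 hR; subst hv3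
    have htmp := execOps_cons_fwd hR; clear hR; obtain ⟨v4, hv4, hR⟩ := htmp
    simp -failIfUnchanged (disch := omega) only [Operand.write, Operand.read, merge_apply_of_lt,
        merge_apply_of_le, Function.update_self, Function.update_of_ne, update_merge_of_lt,
        update_merge_of_le, Nat.add_zero, BinOp.eval_mod, BinOp.eval_eq, BinOp.eval_band,
        BinOp.eval_shr, BinOp.eval_div, BinOp.eval_lt, BinOp.eval_add_of_lt, BinOp.eval_sub_of_le,
        BinOp.eval_mul_of_lt, h25, h28, h29, h40] at hv4 hR; subst hv4
    have htmp := execOps_cons_fwd hR; clear hR; obtain ⟨v5, hv5, hR⟩ := htmp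
    simp -failIfUnchanged (disch := omega) only [Operand.write, Operand.read, merge_apply_of_lt,
        merge_apply_of_le, Function.update_self, Function.update_of_ne, update_merge_of_lt,
        update_merge_of_le, Nat.add_zero, BinOp.eval_mod, BinOp.eval_eq, BinOp.eval_band,
        BinOp.eval_shr, BinOp.eval_div, BinOp.eval_lt, BinOp.eval_add_of_lt, BinOp.eval_sub_of_le,
        BinOp.eval_mul_of_lt, h25, h28, h29, h40] at hv5 hR; subst hv5
    have htmp := execOps_cons_fwd hR; clear hR; obtain ⟨v6, hv6, hR⟩ := htmp
    simp -failIfUnchanged (disch := omega) only [Operand.write, Operand.read, merge_apply_of_lt,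
        merge_apply_of_le, Function.update_self, Function.update_of_ne, update_merge_of_lt,
        update_merge_of_le, Nat.add_zero, BinOp.eval_mod, BinOp.eval_eq, BinOp.eval_band,
        BinOp.eval_shr, BinOp.eval_div, BinOp.eval_lt, BinOp.eval_add_of_lt, BinOp.eval_sub_of_le,
        BinOp.eval_mul_of_lt, h25, h28, h29, h40] at hv6 hR; subst hv6
    have htmp := execOps_cons_fwd hR; clear hR; obtain ⟨v7, hv7, hR⟩ := htmp
    simp -failIfUnchanged (disch := omega) only [Operand.write, Operand.read, merge_apply_of_lt,
        merge_apply_of_le, Function.update_self, Function.update_of_ne, update_merge_of_lt,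
        update_merge_of_le, Nat.add_zero, BinOp.eval_mod, BinOp.eval_eq, BinOp.eval_band,
        BinOp.eval_shr, BinOp.eval_div, BinOp.eval_lt, BinOp.eval_add_of_lt, BinOp.eval_sub_of_le,
        BinOp.eval_mul_of_lt, h25, h28, h29, h40] at hv7 hR; subst hv7
    have htmp := execOps_cons_fwd hR; clear hR; obtain ⟨v8, hv8, hR⟩ := htmp
    simp -failIfUnchanged (disch := omega) only [Operand.write, Operand.read, merge_apply_of_lt,
        merge_apply_of_le, Function.update_self, Function.update_of_ne, update_merge_of_lt,
        update_merge_of_le, Nat.add_zero, BinOp.eval_mod, BinOp.eval_eq, BinOp.eval_band,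
        BinOp.eval_shr, BinOp.eval_div, BinOp.eval_lt, BinOp.eval_add_of_lt, BinOp.eval_sub_of_le,
        BinOp.eval_mul_of_lt, h25, h28, h29, h40] at hv8 hR; subst hv8
    simp only [execOps_nil] at hR; subst hR
    refine ⟨_, rfl, ⟨by simp, by simp, by simp, by simp, by simp, by simp, by simp⟩, fun r hr => ?_⟩
    rw [Function.update_of_ne (by omega), Function.update_of_ne (by omega), Function.update_of_ne (by omega),
      Function.update_of_ne (by omega), Function.update_of_ne (by omega), Function.update_of_ne (by omega),
      Function.update_of_ne (by omega), Function.update_of_ne (by omega)]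
  exact ⟨S₁, hex₁, h⟩

set_option linter.unusedSimpArgs false in
/-- **Moving to the next triple**: `tr := tr + 1`, `rem := rem - 1`. [folklore] -/
theorem next_spec {S H : ℕ → ℕ} {qs : List (List ℕ)} {tr rem : ℕ} (h40 : S 40 = tr) (h41 : S 41 = rem)
    (hrem : 1 ≤ rem) (htr : tr + 1 < 2 ^ w) (hremw : rem < 2 ^ w) :
    ∃ S₁, Exec w O (block [(.add, .dir 40, .dir 40, .imm 1), (.sub, .dir 41, .dir 41, .imm 1)])
        ⟨merge S H, qs⟩ ⟨merge S₁ H, qs⟩ 2 ∧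
      S₁ 40 = tr + 1 ∧ S₁ 41 = rem - 1 ∧ ∀ r, r ≠ 40 → r ≠ 41 → S₁ r = S r := by
  obtain ⟨st₁, hex₁, S₁, rfl, h⟩ : ∃ st₁, Exec w O (block [(.add, .dir 40, .dir 40, .imm 1),
      (.sub, .dir 41, .dir 41, .imm 1)]) ⟨merge S H, qs⟩ st₁ 2 ∧ ∃ S₁, st₁ = ⟨merge S₁ H, qs⟩ ∧
      (S₁ 40 = tr + 1 ∧ S₁ 41 = rem - 1 ∧ ∀ r, r ≠ 40 → r ≠ 41 → S₁ r = S r) := by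
    refine Exec.block_of_fwd _ _ fun R hR => ?_
    have htmp := execOps_cons_fwd hR; clear hR; obtain ⟨v1, hv1, hR⟩ := htmp
    simp -failIfUnchanged (disch := omega) only [Operand.write, Operand.read, merge_apply_of_lt,
        merge_apply_of_le, Function.update_self, Function.update_of_ne, update_merge_of_lt,
        update_merge_of_le, Nat.add_zero, BinOp.eval_mod, BinOp.eval_eq, BinOp.eval_band,
        BinOp.eval_shr, BinOp.eval_div, BinOp.eval_lt, BinOp.eval_add_of_lt, BinOp.eval_sub_of_le,
        BinOp.eval_mul_of_lt, h40, h41] at hv1 hR; subst hv1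
    have htmp := execOps_cons_fwd hR; clear hR; obtain ⟨v2, hv2, hR⟩ := htmp
    simp -failIfUnchanged (disch := omega) only [Operand.write, Operand.read, merge_apply_of_lt,
        merge_apply_of_le, Function.update_self, Function.update_of_ne, update_merge_of_lt,
        update_merge_of_le, Nat.add_zero, BinOp.eval_mod, BinOp.eval_eq, BinOp.eval_band,
        BinOp.eval_shr, BinOp.eval_div, BinOp.eval_lt, BinOp.eval_add_of_lt, BinOp.eval_sub_of_le,
        BinOp.eval_mul_of_lt, h40, h41] at hv2 hR; subst hv2
    simp only [execOps_nil] at hR; subst hR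
    exact ⟨_, rfl, by simp, by simp, fun r h1 h2 => by rw [Function.update_of_ne h2, Function.update_of_ne h1]⟩
  exact ⟨S₁, hex₁, h⟩

set_option linter.unusedSimpArgs false in
/-- **Deleting the found pair** (`markOps`): stamp `fd[(bi L + i) n + (bj L + j)] := pw`. [folklore] -/
theorem mark_spec {S H : ℕ → ℕ} {qs : List (List ℕ)} {n' F' bi bj L i j pw : ℕ} (h2 : S 2 = n') (h24 : S 24 = pw)
    (h25 : S 25 = L) (h32 : S 32 = F' + n' * n') (h42 : S 42 = bi) (h43 : S 43 = bj) (h45 : S 45 = i)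
    (h47 : S 47 = j) (hi : bi * L + i < n') (hj : bj * L + j < n') (hF : 100 ≤ F') (hw : F' + 2 * (n' * n') < 2 ^ w)
    (hpw : pw < 2 ^ w) :
    ∃ S₁, Exec w O (block markOps) ⟨merge S H, qs⟩
        ⟨merge S₁ (Function.update H (F' + n' * n' + ((bi * L + i) * n' + (bj * L + j))) pw), qs⟩ 8 ∧
      ∀ r, r < 74 ∨ 81 < r → S₁ r = S r := by
  have hidx : (bi * L + i) * n' + (bj * L + j) < n' * n' := NegTriToAPSP.mul_add_lt_mul hi hj
  have hnn : n' ≤ n' * n' := Nat.le_mul_self n'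
  obtain ⟨st₁, hex₁, S₁, rfl, h⟩ : ∃ st₁, Exec w O (block markOps) ⟨merge S H, qs⟩ st₁ 8 ∧
      ∃ S₁, st₁ = ⟨merge S₁ (Function.update H (F' + n' * n' + ((bi * L + i) * n' + (bj * L + j))) pw), qs⟩ ∧
        (∀ r, r < 74 ∨ 81 < r → S₁ r = S r) := by
    refine Exec.block_of_fwd _ _ fun R hR => ?_
    unfold markOps at hR
    have htmp := execOps_cons_fwd hR; clear hR; obtain ⟨v1, hv1, hR⟩ := htmp
    simp -failIfUnchanged (disch := omega) only [Operand.write, Operand.read, merge_apply_of_lt,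
        merge_apply_of_le, Function.update_self, Function.update_of_ne, update_merge_of_lt,
        update_merge_of_le, Nat.add_zero, BinOp.eval_mod, BinOp.eval_eq, BinOp.eval_band,
        BinOp.eval_shr, BinOp.eval_div, BinOp.eval_lt, BinOp.eval_add_of_lt, BinOp.eval_sub_of_le,
        BinOp.eval_mul_of_lt, h2, h24, h25, h32, h42, h43, h45, h47] at hv1 hR; subst hv1
    have htmp := execOps_cons_fwd hR; clear hR; obtain ⟨v2, hv2, hR⟩ := htmp
    simp -failIfUnchanged (disch := omega) only [Operand.write, Operand.read, merge_apply_of_lt,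
        merge_apply_of_le, Function.update_self, Function.update_of_ne, update_merge_of_lt,
        update_merge_of_le, Nat.add_zero, BinOp.eval_mod, BinOp.eval_eq, BinOp.eval_band,
        BinOp.eval_shr, BinOp.eval_div, BinOp.eval_lt, BinOp.eval_add_of_lt, BinOp.eval_sub_of_le,
        BinOp.eval_mul_of_lt, h2, h24, h25, h32, h42, h43, h45, h47] at hv2 hR; subst hv2
    have htmp := execOps_cons_fwd hR; clear hR; obtain ⟨v3, hv3, hR⟩ := htmp
    simp -failIfUnchanged (disch := omega) only [Operand.write, Operand.read, merge_apply_of_lt,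
        merge_apply_of_le, Function.update_self, Function.update_of_ne, update_merge_of_lt,
        update_merge_of_le, Nat.add_zero, BinOp.eval_mod, BinOp.eval_eq, BinOp.eval_band,
        BinOp.eval_shr, BinOp.eval_div, BinOp.eval_lt, BinOp.eval_add_of_lt, BinOp.eval_sub_of_le,
        BinOp.eval_mul_of_lt, h2, h24, h25, h32, h42, h43, h45, h47] at hv3 hR; subst hv3
    have htmp := execOps_cons_fwd hR; clear hR; obtain ⟨v4, hv4, hR⟩ := htmp
    simp -failIfUnchanged (disch := omega) only [Operand.write, Operand.read, merge_apply_of_lt,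
        merge_apply_of_le, Function.update_self, Function.update_of_ne, update_merge_of_lt,
        update_merge_of_le, Nat.add_zero, BinOp.eval_mod, BinOp.eval_eq, BinOp.eval_band,
        BinOp.eval_shr, BinOp.eval_div, BinOp.eval_lt, BinOp.eval_add_of_lt, BinOp.eval_sub_of_le,
        BinOp.eval_mul_of_lt, h2, h24, h25, h32, h42, h43, h45, h47] at hv4 hR; subst hv4
    have htmp := execOps_cons_fwd hR; clear hR; obtain ⟨v5, hv5, hR⟩ := htmp
    simp -failIfUnchanged (disch := omega) only [Operand.write, Operand.read, merge_apply_of_lt,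
        merge_apply_of_le, Function.update_self, Function.update_of_ne, update_merge_of_lt,
        update_merge_of_le, Nat.add_zero, BinOp.eval_mod, BinOp.eval_eq, BinOp.eval_band,
        BinOp.eval_shr, BinOp.eval_div, BinOp.eval_lt, BinOp.eval_add_of_lt, BinOp.eval_sub_of_le,
        BinOp.eval_mul_of_lt, h2, h24, h25, h32, h42, h43, h45, h47] at hv5 hR; subst hv5
    have htmp := execOps_cons_fwd hR; clear hR; obtain ⟨v6, hv6, hR⟩ := htmp
    simp -failIfUnchanged (disch := omega) only [Operand.write, Operand.read, merge_apply_of_lt,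
        merge_apply_of_le, Function.update_self, Function.update_of_ne, update_merge_of_lt,
        update_merge_of_le, Nat.add_zero, BinOp.eval_mod, BinOp.eval_eq, BinOp.eval_band,
        BinOp.eval_shr, BinOp.eval_div, BinOp.eval_lt, BinOp.eval_add_of_lt, BinOp.eval_sub_of_le,
        BinOp.eval_mul_of_lt, h2, h24, h25, h32, h42, h43, h45, h47] at hv6 hR; subst hv6
    have htmp := execOps_cons_fwd hR; clear hR; obtain ⟨v7, hv7, hR⟩ := htmp
    simp -failIfUnchanged (disch := omega) only [Operand.write, Operand.read, merge_apply_of_lt,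
        merge_apply_of_le, Function.update_self, Function.update_of_ne, update_merge_of_lt,
        update_merge_of_le, Nat.add_zero, BinOp.eval_mod, BinOp.eval_eq, BinOp.eval_band,
        BinOp.eval_shr, BinOp.eval_div, BinOp.eval_lt, BinOp.eval_add_of_lt, BinOp.eval_sub_of_le,
        BinOp.eval_mul_of_lt, h2, h24, h25, h32, h42, h43, h45, h47] at hv7 hR; subst hv7
    have htmp := execOps_cons_fwd hR; clear hR; obtain ⟨v8, hv8, hR⟩ := htmp
    simp -failIfUnchanged (disch := omega) only [Operand.write, Operand.read, merge_apply_of_lt,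
        merge_apply_of_le, Function.update_self, Function.update_of_ne, update_merge_of_lt,
        update_merge_of_le, Nat.add_zero, BinOp.eval_mod, BinOp.eval_eq, BinOp.eval_band,
        BinOp.eval_shr, BinOp.eval_div, BinOp.eval_lt, BinOp.eval_add_of_lt, BinOp.eval_sub_of_le,
        BinOp.eval_mul_of_lt, h2, h24, h25, h32, h42, h43, h45, h47] at hv8 hR; subst hv8
    simp only [execOps_nil] at hR; subst hR
    refine ⟨_, rfl, fun r hr => ?_⟩
    rw [Function.update_of_ne (by omega), Function.update_of_ne (by omega), Function.update_of_ne (by omega),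
      Function.update_of_ne (by omega), Function.update_of_ne (by omega), Function.update_of_ne (by omega),
      Function.update_of_ne (by omega)]
  exact ⟨S₁, hex₁, h⟩

/-! ### Counting the unfound pairs -/

/-- The number of pairs not (yet) found in the current round. [folklore] -/
def unfound (n : ℕ) (fd : ℕ → ℕ) (pw : ℕ) : ℕ := ((Finset.range (n * n)).filter fun t => fd t ≠ pw).card

/-- At most `n²` pairs are unfound. [folklore] -/
theorem unfound_le (n : ℕ) (fd : ℕ → ℕ) (pw : ℕ) : unfound n fd pw ≤ n * n :=
  (Finset.card_filter_le _ _).trans (by simp)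

/-- Stamping an unfound pair decreases the count by one. [folklore] -/
theorem unfound_update {n : ℕ} {fd : ℕ → ℕ} {pw t : ℕ} (ht : t < n * n) (hfd : fd t ≠ pw) :
    unfound n (Function.update fd t pw) pw + 1 = unfound n fd pw := by
  unfold unfound
  have hsplit : ((Finset.range (n * n)).filter fun s => fd s ≠ pw) =
      insert t ((Finset.range (n * n)).filter fun s => Function.update fd t pw s ≠ pw) := by
    ext s
    simp only [Finset.mem_filter, Finset.mem_range, Finset.mem_insert]
    by_cases hst : s = t
    · subst hst; simp [ht, hfd]
    · rw [Function.update_of_ne hst]; simp [hst]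
  rw [hsplit, Finset.card_insert_of_notMem]
  simp

/-- The count read off the memory (for the potential of the search loop). [folklore] -/
def unfoundMem (n F pw : ℕ) (m : ℕ → ℕ) : ℕ :=
  ((Finset.range (n * n)).filter fun t => m (F + n * n + t) ≠ pw).card

/-- Under the data invariant the memory count is the count of the found array. [folklore] -/
theorem unfoundMem_eq {n : ℕ} {q : QData n} {F : ℕ} {H₀ H S : ℕ → ℕ} (hD : DataQ q F H₀ H) (hF : 100 ≤ F) :
    unfoundMem n F q.pw (merge S H) = unfound n q.fd q.pw := by
  unfold unfoundMem unfound
  congr 1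
  refine Finset.filter_congr fun t ht => ?_
  rw [Finset.mem_range] at ht
  rw [merge_apply_of_le (by omega), hD.fd t ht]

end Search

section SearchLoop

variable {w : ℕ} {O : List ℕ → List ℕ} {F : ℕ}

/-- Row-major pair indices are unique: `i n + j = i' n + j'` with `j, j' < n` forces `i = i'`, `j = j'`. [folklore] -/
theorem pair_index_inj {n i j i' j' : ℕ} (hj : j < n) (hj' : j' < n) (h : i * n + j = i' * n + j') :
    i = i' ∧ j = j' := by
  have h1 : (i * n + j) / n = i := NegTriToAPSP.div_of_mul_add hj
  have h2 : (i' * n + j') / n = i' := NegTriToAPSP.div_of_mul_add hj'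
  have hi : i = i' := by rw [← h1, ← h2, h]
  subst hi
  exact ⟨rfl, by omega⟩

/-- Every block triple is enumerated: `(bi nb² + bj nb + bk)` decodes back to `(bi, bj, bk)`. [folklore] -/
theorem triple_decode {nb bi bj bk : ℕ} (hbi : bi < nb) (hbj : bj < nb) (hbk : bk < nb) :
    (bi * (nb * nb) + bj * nb + bk) / (nb * nb) = bi ∧ (bi * (nb * nb) + bj * nb + bk) / nb % nb = bj ∧
      (bi * (nb * nb) + bj * nb + bk) % nb = bk ∧ bi * (nb * nb) + bj * nb + bk < nb * nb * nb := by
  have hnb : 0 < nb := by omega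
  have hlt : bj * nb + bk < nb * nb := NegTriToAPSP.mul_add_lt_mul hbj hbk
  refine ⟨?_, ?_, ?_, ?_⟩
  · rw [Nat.add_assoc, NegTriToAPSP.div_of_mul_add hlt]
  · rw [Nat.add_assoc, show bi * (nb * nb) + (bj * nb + bk) = (bj * nb + bk) + (bi * nb) * nb by ring,
      Nat.add_mul_div_right _ _ hnb, NegTriToAPSP.div_of_mul_add hbk, Nat.add_mul_mod_self_right,
      Nat.mod_eq_of_lt hbj]
  · rw [show bi * (nb * nb) + bj * nb + bk = bk + (bi * nb + bj) * nb by ring, Nat.add_mul_mod_self_right,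
      Nat.mod_eq_of_lt hbk]
  · calc bi * (nb * nb) + bj * nb + bk = bi * (nb * nb) + (bj * nb + bk) := by ring
      _ < bi * (nb * nb) + nb * nb := by omega
      _ = (bi + 1) * (nb * nb) := by ring
      _ ≤ nb * (nb * nb) := Nat.mul_le_mul_right _ hbi
      _ = nb * nb * nb := by ring

/-- Arithmetic of the triple counter. [folklore] -/
theorem tsub_succ_add {a tr u : ℕ} (h : tr < a) : a - (tr + 1) + u + 1 = a - tr + u := by omega

/-- Arithmetic of the triple counter. [folklore] -/
theorem tsub_sub_one_add {a tr u : ℕ} (h : tr < a) : a - tr - 1 + u + 1 = a - tr + u := by omega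

/-- `x c + c = (x + 1) c`. [folklore] -/
theorem mul_add_self_eq_succ_mul (x c : ℕ) : x * c + c = (x + 1) * c := (Nat.succ_mul x c).symm

/-- **The time of one search step**: one query on the triple, at most two bisections, the
bookkeeping. [folklore] -/
def tIter (L : ℕ) : ℕ := tAsk L + 2 * ((tAsk L + 13) * Nat.size (L - 1)) + 24

/-- **The invariant of the search of one round** (VW–W, proof of Lemma 4.2): the triples below the
counter `tr = r40` (`r41 = nb³ - tr`) have no witness left; every stamped pair (`fd = pw`) has its
searched value below its threshold (soundness); the stamps are `0` or at least `pw` and at most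
`4M + 1`; the number of queries so far plus `(remaining triples + unfound pairs) · (1 + 2 size (L - 1))`
stays within the budget `B₀`; all queries are well-formed instances of size `3L`. [folklore] -/
def SInv (c' : ℕ) (X Y : Matrix (Fin n) (Fin n) (WithTop ℤ)) (lo : ℕ → ℕ) (M pw L pX pY F P : ℕ)
    (H₀ : ℕ → ℕ) (qs₀ : List (List ℕ)) (B₀ : ℕ) (S₀ : ℕ → ℕ) (st : Store) : Prop :=
  ∃ (S H fd : ℕ → ℕ) (bs : List (NegativeTriangle c').Inst) (tr : ℕ),
    st = ⟨merge S H, qs₀ ++ bs.map (NegativeTriangle c').encode⟩ ∧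
    KRegs n F pX pY M L (nblk n) pw S ∧ (∀ r, r < 20 → S r = S₀ r) ∧ S 40 = tr ∧ S 41 = nblk n * nblk n * nblk n - tr ∧
    tr ≤ nblk n * nblk n * nblk n ∧ DataQ (mkQ X Y lo fd M pw L 0 0 0) F H₀ H ∧
    (∀ t, t < n * n → fd t = 0 ∨ pw ≤ fd t) ∧ (∀ t, t < n * n → fd t ≤ 4 * M + 1) ∧
    (∀ i j : Fin n, fd (i * n + j) = pw → tval X Y M P i j < lo (i * n + j) + pw) ∧
    (∀ tr', tr' < tr →
      NoWit X Y lo fd M pw L (tr' / (nblk n * nblk n)) (tr' / nblk n % nblk n) (tr' % nblk n)) ∧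
    bs.length + (nblk n * nblk n * nblk n - tr + unfound n fd pw) * (1 + 2 * Nat.size (L - 1)) ≤ B₀ ∧
    ∀ y ∈ bs, (NegativeTriangle c').size y = 3 * L ∧ ((NegativeTriangle c').encode y).length = 9 * (L * L) + 1

/-- **One step of the search** keeps the invariant and is paid for by the potential
`(remaining triples + unfound pairs) · (tIter L + 2)`: a no-answer retires the triple, a yes-answer
locates (two bisections) and stamps a pair that was unfound. [folklore] -/
theorem searchBody_spec (hG : Geo n w F pX pY M) (hR : RFacts c' X Y lo M pw L pX pY H₀)
    (hO : (NegativeTriangle c').OracleAnswers O) {P : ℕ} (hs : ∀ t, t < n * n → lo t + pw ≤ P - 1)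
    (hpwM : pw ≤ 4 * M + 1) {qs₀ : List (List ℕ)} {B₀ : ℕ} {S₀ : ℕ → ℕ} {st : Store}
    (hst : SInv c' X Y lo M pw L pX pY F P H₀ qs₀ B₀ S₀ st) (hne : (Operand.dir 41).read st.mem ≠ 0) :
    ∃ st' t, Exec w O searchBody st st' t ∧ SInv c' X Y lo M pw L pX pY F P H₀ qs₀ B₀ S₀ st' ∧
      t + 2 + (st'.mem 41 + unfoundMem n F pw st'.mem) * (tIter L + 2) ≤
        (st.mem 41 + unfoundMem n F pw st.mem) * (tIter L + 2) := by
  obtain ⟨S, H, fd, bs, tr, rfl, hK, hlow, h40, h41, htr, hD, hst0, hfdM, hsound, hcomp, hbudget, hbs⟩ := hst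
  obtain ⟨hn, hpX, hpY, hpYF, hFw, hMw, hn3w⟩ := id hG
  have hbigM : big M = 16 * M + 4 := rfl
  have hL1 : 1 ≤ L := hR.hL0
  have hLn : L ≤ n := hR.hL ▸ cubeRt_le n
  have hnn : n ≤ n * n := Nat.le_mul_self n
  have hnb : nblk n ≤ n := nblk_le hn
  have hnb2 : nblk n * nblk n ≤ n * n := Nat.mul_le_mul hnb hnb
  have hnb3 : nblk n * nblk n * nblk n ≤ n * n * n := Nat.mul_le_mul hnb2 hnb
  have hwsp : wspNT n = 2 * (n * n) + 9 * (L * L) + 3 := by rw [hR.hL]; rfl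
  have hfdb : ∀ t, t < n * n → fd t ≤ 8 * M + 2 := fun t ht => (hfdM t ht).trans (by omega)
  have h41' : S 41 ≠ 0 := by
    rwa [show (Operand.dir 41).read (merge S H) = S 41 from merge_apply_of_lt (by norm_num)] at hne
  have htr' : tr < nblk n * nblk n * nblk n := by rw [h41] at h41'; omega
  have hnbpos : 0 < nblk n := by
    rcases Nat.eq_zero_or_pos (nblk n) with h0 | h0
    · rw [h0] at htr'; simp at htr'
    · exact h0
  set bi := tr / (nblk n * nblk n) with hbi_def
  set bj := tr / nblk n % nblk n with hbj_def
  set bk := tr % nblk n with hbk_def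
  have hbi : bi < nblk n := Nat.div_lt_of_lt_mul htr'
  have hbj : bj < nblk n := Nat.mod_lt _ hnbpos
  have hbk : bk < nblk n := Nat.mod_lt _ hnbpos
  have hD' : DataQ (mkQ X Y lo fd M pw L bi bj bk) F H₀ H := ⟨hD.below, hD.lo, hD.fd, hD.zero⟩
  have hUmem : unfoundMem n F pw (merge S H) = unfound n fd pw := unfoundMem_eq (q := mkQ X Y lo fd M pw L bi bj bk) hD' (by omega)
  -- the triple registers
  obtain ⟨S₁, hex₁, hW₁, hS₁⟩ := triple_spec (w := w) (O := O) (H := H) (qs := qs₀ ++ bs.map (NegativeTriangle c').encode)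
    hK.r25 hK.r28 hK.r29 h40 (by omega)
  have hK₁ : KRegs n F pX pY M L (nblk n) pw S₁ := hK.of_agree fun r hr => hS₁ r (by omega)
  -- the query on the triple with full windows
  have hQ₀ : QFacts c' (mkQ X Y lo fd M pw L bi bj bk) pX pY H₀ := hR.qfacts fd hbi hbj hbk le_rfl le_rfl
  obtain ⟨S₂, H₂, ⟨t₂, ht₂', hex₂⟩, hK₂', hW₂', h49, hfr₂, hD₂⟩ := ask_spec (qs := qs₀ ++ bs.map (NegativeTriangle c').encode)
    hG hQ₀ hfdb hO hK₁ hW₁ hD'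
  have ht₂ : t₂ ≤ tAsk L := ht₂'
  have hK₂ : KRegs n F pX pY M L (nblk n) pw S₂ := hK₂'
  have hW₂ : WRegs bi bj bk 0 L 0 L S₂ := hW₂'
  clear ht₂' hK₂' hW₂'
  have h40₂ : S₂ 40 = tr := (hfr₂ 40 (by omega) (by omega) (by omega)).trans ((hS₁ 40 (by omega)).trans h40)
  have h41₂ : S₂ 41 = nblk n * nblk n * nblk n - tr :=
    (hfr₂ 41 (by omega) (by omega) (by omega)).trans ((hS₁ 41 (by omega)).trans h41)
  have hqs : qs₀ ++ bs.map (NegativeTriangle c').encode ++ [(NegativeTriangle c').encode hQ₀.ok.inst] =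
      qs₀ ++ (bs ++ [hQ₀.ok.inst]).map (NegativeTriangle c').encode := by simp
  rw [hqs] at hex₂
  have hbs' : ∀ y ∈ bs ++ [hQ₀.ok.inst], (NegativeTriangle c').size y = 3 * L ∧
      ((NegativeTriangle c').encode y).length = 9 * (L * L) + 1 := by
    intro y hy
    rcases List.mem_append.1 hy with hy | hy
    · exact hbs y hy
    · rw [List.mem_singleton.1 hy]; exact ⟨hQ₀.ok.size_inst, hQ₀.ok.length_encode_inst⟩
  have hwit_iff : (mkQ X Y lo fd M pw L bi bj bk).Witness ↔
      ∃ iu iv, iu < L ∧ iv < L ∧ (mkQ X Y lo fd M pw L bi bj bk).PairWit iu iv :=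
    QData.witness_full_iff (mkQ X Y lo fd M pw L bi bj bk)
  have hSZ : 1 ≤ 1 + 2 * Nat.size (L - 1) := by omega
  by_cases hans : ansOf (mkQ X Y lo fd M pw L bi bj bk) = 0
  · -- no witness in this triple: move on
    have hnow : NoWit X Y lo fd M pw L bi bj bk := fun iu iv hiu hiv hw =>
      ((ansOf_ne_zero_iff _).2 (hwit_iff.2 ⟨iu, iv, hiu, hiv, hw⟩)) hans
    have h49' : (Operand.dir 49).read (merge S₂ H₂) = 0 := by rw [Operand.read_dir_merge (by norm_num), h49, hans]
    obtain ⟨S₃, hex₃, h40₃, h41₃, hS₃⟩ := next_spec (w := w) (O := O) (H := H₂)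
      (qs := qs₀ ++ (bs ++ [hQ₀.ok.inst]).map (NegativeTriangle c').encode) h40₂ h41₂ (by omega) (by omega) (by omega)
    have hD₃ : DataQ (mkQ X Y lo fd M pw L 0 0 0) F H₀ H₂ := ⟨hD₂.below, hD₂.lo, hD₂.fd, hD₂.zero⟩
    have hU₃ : unfoundMem n F pw (merge S₃ H₂) = unfound n fd pw := unfoundMem_eq (q := mkQ X Y lo fd M pw L 0 0 0) hD₃ (by omega)
    refine ⟨_, _, hex₁.seqs_cons (hex₂.seqs_cons (Exec.seqs_one (Exec.ifz_zero h49' hex₃))),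
      ⟨S₃, H₂, fd, bs ++ [hQ₀.ok.inst], tr + 1, rfl, hK₂.of_agree fun r hr => hS₃ r (by omega) (by omega),
        fun r hr => ?_, h40₃, by rw [h41₃]; omega, htr', hD₃, hst0, hfdM, hsound, fun tr' htr' => ?_, ?_, hbs'⟩, ?_⟩
    · rw [hS₃ r (by omega) (by omega), hfr₂ r (by omega) (by omega) (by omega), hS₁ r (by omega), hlow r hr]
    · rcases Nat.lt_succ_iff_lt_or_eq.1 htr' with h | rfl
      · exact hcomp tr' h
      · exact hnow
    · rw [List.length_append, List.length_singleton]
      have hA : nblk n * nblk n * nblk n - (tr + 1) + unfound n fd pw + 1 =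
          nblk n * nblk n * nblk n - tr + unfound n fd pw := tsub_succ_add htr'
      have : (nblk n * nblk n * nblk n - (tr + 1) + unfound n fd pw) * (1 + 2 * Nat.size (L - 1)) +
          (1 + 2 * Nat.size (L - 1)) = (nblk n * nblk n * nblk n - tr + unfound n fd pw) * (1 + 2 * Nat.size (L - 1)) := by
        rw [← hA]; exact mul_add_self_eq_succ_mul _ _
      omega
    · show 8 + (t₂ + (2 + 1)) + 2 + (merge S₃ H₂ 41 + unfoundMem n F pw (merge S₃ H₂)) * (tIter L + 2) ≤
        (merge S H 41 + unfoundMem n F pw (merge S H)) * (tIter L + 2)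
      rw [merge_apply_of_lt (by norm_num), merge_apply_of_lt (by norm_num), h41₃, h41, hU₃, hUmem]
      have hA : nblk n * nblk n * nblk n - tr - 1 + unfound n fd pw + 1 =
          nblk n * nblk n * nblk n - tr + unfound n fd pw := tsub_sub_one_add htr'
      have : (nblk n * nblk n * nblk n - tr - 1 + unfound n fd pw) * (tIter L + 2) + (tIter L + 2) =
          (nblk n * nblk n * nblk n - tr + unfound n fd pw) * (tIter L + 2) := by
        rw [← hA]; exact mul_add_self_eq_succ_mul _ _
      have hT : tIter L = tAsk L + 2 * ((tAsk L + 13) * Nat.size (L - 1)) + 24 := rfl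
      omega
  · -- a witness: locate it and stamp it
    have h49' : (Operand.dir 49).read (merge S₂ H₂) ≠ 0 := by rw [Operand.read_dir_merge (by norm_num), h49]; exact hans
    obtain ⟨iu₀, iv₀, hiu₀, hiv₀, hw₀⟩ := hwit_iff.1 ((ansOf_ne_zero_iff _).1 hans)
    have hD₂' : DataQ (mkQ X Y lo fd M pw L bi bj bk) F H₀ H₂ := ⟨hD₂.below, hD₂.lo, hD₂.fd, hD₂.zero⟩
    obtain ⟨S₃, H₃, bsR, i, ⟨tR, htR, hexR⟩, hK₃, hW₃, hi, ⟨iu, hiu, -, -, hwI⟩, hfr₃, hD₃, hlenR, hbsR⟩ :=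
      bisRows_spec (qs₀ := qs₀ ++ (bs ++ [hQ₀.ok.inst]).map (NegativeTriangle c').encode) hG hR hfdb hO hbi hbj hbk
        le_rfl hK₂ hW₂ hD₂' ⟨iu₀, iv₀, hiu₀, hiv₀, Nat.zero_le _, hiu₀, hw₀⟩
    obtain ⟨S₄, H₄, bsC, j, ⟨tC, htC, hexC⟩, hK₄, hW₄, hj, hwJ, hfr₄, hD₄, hlenC, hbsC⟩ :=
      bisCols_spec (qs₀ := qs₀ ++ (bs ++ [hQ₀.ok.inst]).map (NegativeTriangle c').encode ++ bsR.map (NegativeTriangle c').encode)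
        hG hR hfdb hO hbi hbj hbk hi hK₃ hW₃ hD₃ ⟨iu, hiu, hwI⟩
    obtain ⟨hgi, hgj, hfdne, -⟩ := id hwJ
    set idx := (bi * L + i) * n + (bj * L + j) with hidx_def
    have hidx : idx < n * n := NegTriToAPSP.mul_add_lt_mul hgi hgj
    have hsnd := tval_lt_of_pairWit (P := P) hR.hX hR.hY hwJ (i := ⟨bi * L + i, hgi⟩) (j := ⟨bj * L + j, hgj⟩) rfl rfl
      (hs idx hidx)
    obtain ⟨S₅, hex₅, hS₅⟩ := mark_spec (w := w) (O := O) (H := H₄) (n' := n) (F' := F)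
      (qs := qs₀ ++ (bs ++ [hQ₀.ok.inst]).map (NegativeTriangle c').encode ++ bsR.map (NegativeTriangle c').encode ++
        bsC.map (NegativeTriangle c').encode)
      hK₄.r2 hK₄.r24 hK₄.r25 hK₄.r32 hW₄.r42 hW₄.r43 hW₄.r45 hW₄.r47 hgi hgj (by omega) (by omega) (by omega)
    have hDm := hD₄.mark hidx (by omega)
    set fd' := Function.update fd idx pw with hfd'
    have hD₅ : DataQ (mkQ X Y lo fd' M pw L 0 0 0) F H₀ (Function.update H₄ (F + n * n + idx) pw) :=
      ⟨hDm.below, hDm.lo, hDm.fd, hDm.zero⟩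
    have hU₅ : unfoundMem n F pw (merge S₅ (Function.update H₄ (F + n * n + idx) pw)) = unfound n fd' pw :=
      unfoundMem_eq (q := mkQ X Y lo fd' M pw L 0 0 0) hD₅ (by omega)
    have hUfd : unfound n fd' pw + 1 = unfound n fd pw := unfound_update hidx hfdne
    have hqs₅ : qs₀ ++ (bs ++ [hQ₀.ok.inst]).map (NegativeTriangle c').encode ++ bsR.map (NegativeTriangle c').encode ++
        bsC.map (NegativeTriangle c').encode = qs₀ ++ (bs ++ [hQ₀.ok.inst] ++ bsR ++ bsC).map (NegativeTriangle c').encode := by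
      simp
    refine ⟨_, _, hex₁.seqs_cons (hex₂.seqs_cons (Exec.seqs_one (Exec.ifz_ne h49'
      (hexR.seqs_cons (hexC.seqs_cons (Exec.seqs_one hex₅)))))),
      ⟨S₅, _, fd', bs ++ [hQ₀.ok.inst] ++ bsR ++ bsC, tr, by rw [hqs₅], hK₄.of_agree fun r hr => hS₅ r (by omega),
        fun r hr => ?_, ?_, ?_,
        htr, hD₅, fun t ht => ?_, fun t ht => ?_, fun i' j' hij => ?_, fun tr' htr' => (hcomp tr' htr').update idx, ?_, ?_⟩, ?_⟩
    · rw [hS₅ r (by omega), hfr₄ r (by omega) (by omega), hfr₃ r (by omega) (by omega), hfr₂ r (by omega) (by omega) (by omega),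
        hS₁ r (by omega), hlow r hr]
    · rw [hS₅ 40 (by omega), hfr₄ 40 (by omega) (by omega), hfr₃ 40 (by omega) (by omega), h40₂]
    · rw [hS₅ 41 (by omega), hfr₄ 41 (by omega) (by omega), hfr₃ 41 (by omega) (by omega), h41₂]
    · rw [hfd']
      by_cases hti : t = idx
      · subst hti; rw [Function.update_self]; exact Or.inr le_rfl
      · rw [Function.update_of_ne hti]; exact hst0 t ht
    · rw [hfd']
      by_cases hti : t = idx
      · subst hti; rw [Function.update_self]; exact hpwM
      · rw [Function.update_of_ne hti]; exact hfdM t ht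
    · by_cases hti : (i' : ℕ) * n + j' = idx
      · obtain ⟨h1, h2⟩ := pair_index_inj j'.isLt hgj hti
        have ei : i' = ⟨bi * L + i, hgi⟩ := Fin.ext h1
        have ej : j' = ⟨bj * L + j, hgj⟩ := Fin.ext h2
        subst ei ej
        exact hsnd.2
      · rw [hfd', Function.update_of_ne hti] at hij
        exact hsound i' j' hij
    · simp only [List.length_append, List.length_singleton]
      have hA : nblk n * nblk n * nblk n - tr + unfound n fd' pw + 1 =
          nblk n * nblk n * nblk n - tr + unfound n fd pw := by rw [Nat.add_assoc, hUfd]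
      have : (nblk n * nblk n * nblk n - tr + unfound n fd' pw) * (1 + 2 * Nat.size (L - 1)) +
          (1 + 2 * Nat.size (L - 1)) = (nblk n * nblk n * nblk n - tr + unfound n fd pw) * (1 + 2 * Nat.size (L - 1)) := by
        rw [← hA]; exact mul_add_self_eq_succ_mul _ _
      omega
    · intro y hy
      simp only [List.mem_append] at hy
      rcases hy with (hy | hy) | hy
      · exact hbs' y (List.mem_append.2 hy)
      · exact hbsR y hy
      · exact hbsC y hy
    · show 8 + (t₂ + ((tR + (tC + 8)) + 2)) + 2 +
          (merge S₅ (Function.update H₄ (F + n * n + idx) pw) 41 +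
            unfoundMem n F pw (merge S₅ (Function.update H₄ (F + n * n + idx) pw))) * (tIter L + 2) ≤
        (merge S H 41 + unfoundMem n F pw (merge S H)) * (tIter L + 2)
      rw [merge_apply_of_lt (by norm_num), merge_apply_of_lt (by norm_num), hS₅ 41 (by omega),
        hfr₄ 41 (by omega) (by omega), hfr₃ 41 (by omega) (by omega), h41₂, h41, hU₅, hUmem]
      have hA : nblk n * nblk n * nblk n - tr + unfound n fd' pw + 1 =
          nblk n * nblk n * nblk n - tr + unfound n fd pw := by rw [Nat.add_assoc, hUfd]
      have : (nblk n * nblk n * nblk n - tr + unfound n fd' pw) * (tIter L + 2) + (tIter L + 2) =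
          (nblk n * nblk n * nblk n - tr + unfound n fd pw) * (tIter L + 2) := by
        rw [← hA]; exact mul_add_self_eq_succ_mul _ _
      have hT : tIter L = tAsk L + 2 * ((tAsk L + 13) * Nat.size (L - 1)) + 24 := rfl
      omega

end SearchLoop

section SearchRun

variable {w : ℕ} {O : List ℕ → List ℕ} {F : ℕ}

/-- The time of the search of one round. [folklore] -/
def tSearch (n L : ℕ) : ℕ := (nblk n * nblk n * nblk n + n * n) * (tIter L + 2) + 4

/-- The query budget of the search of one round. [folklore] -/
def qSearch (n L : ℕ) : ℕ := (nblk n * nblk n * nblk n + n * n) * (1 + 2 * Nat.size (L - 1))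

set_option linter.unusedSimpArgs false in
/-- Initialising the triple counter: `tr := 0`, `rem := nb³`. [folklore] -/
theorem searchInit_spec {S H : ℕ → ℕ} {qs : List (List ℕ)} {nb3 : ℕ} (h30 : S 30 = nb3) (hw : nb3 < 2 ^ w) :
    ∃ S₁, Exec w O (block [(.add, .dir 40, .imm 0, .imm 0), (.add, .dir 41, .dir 30, .imm 0)])
        ⟨merge S H, qs⟩ ⟨merge S₁ H, qs⟩ 2 ∧
      S₁ 40 = 0 ∧ S₁ 41 = nb3 ∧ ∀ r, r ≠ 40 → r ≠ 41 → S₁ r = S r := by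
  obtain ⟨st₁, hex₁, S₁, rfl, h⟩ : ∃ st₁, Exec w O (block [(.add, .dir 40, .imm 0, .imm 0),
      (.add, .dir 41, .dir 30, .imm 0)]) ⟨merge S H, qs⟩ st₁ 2 ∧ ∃ S₁, st₁ = ⟨merge S₁ H, qs⟩ ∧
      (S₁ 40 = 0 ∧ S₁ 41 = nb3 ∧ ∀ r, r ≠ 40 → r ≠ 41 → S₁ r = S r) := by
    refine Exec.block_of_fwd _ _ fun R hR => ?_
    have htmp := execOps_cons_fwd hR; clear hR; obtain ⟨v1, hv1, hR⟩ := htmp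
    simp -failIfUnchanged (disch := omega) only [Operand.write, Operand.read, merge_apply_of_lt,
        merge_apply_of_le, Function.update_self, Function.update_of_ne, update_merge_of_lt,
        update_merge_of_le, Nat.add_zero, BinOp.eval_mod, BinOp.eval_eq, BinOp.eval_band,
        BinOp.eval_shr, BinOp.eval_div, BinOp.eval_lt, BinOp.eval_add_of_lt, BinOp.eval_sub_of_le,
        BinOp.eval_mul_of_lt, h30] at hv1 hR; subst hv1
    have htmp := execOps_cons_fwd hR; clear hR; obtain ⟨v2, hv2, hR⟩ := htmp
    simp -failIfUnchanged (disch := omega) only [Operand.write, Operand.read, merge_apply_of_lt,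
        merge_apply_of_le, Function.update_self, Function.update_of_ne, update_merge_of_lt,
        update_merge_of_le, Nat.add_zero, BinOp.eval_mod, BinOp.eval_eq, BinOp.eval_band,
        BinOp.eval_shr, BinOp.eval_div, BinOp.eval_lt, BinOp.eval_add_of_lt, BinOp.eval_sub_of_le,
        BinOp.eval_mul_of_lt, h30] at hv2 hR; subst hv2
    simp only [execOps_nil] at hR; subst hR
    exact ⟨_, rfl, by simp, by simp, fun r h1 h2 => by rw [Function.update_of_ne h2, Function.update_of_ne h1]⟩
  exact ⟨S₁, hex₁, h⟩

/-- **The search of one round** (VW–W, proof of Lemma 4.2 driving one iteration of the binary search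
of Thm. 4.2): afterwards the stamped pairs are exactly the pairs whose searched value lies below
their threshold (soundness from `tval_lt_of_pairWit`, completeness from `found_of_tval_lt`), the
stamps are `0` or in `[pw, 4M + 1]`, at most `qSearch n L` well-formed queries were made, within
`tSearch n L` steps. [folklore] -/
theorem search_spec (hG : Geo n w F pX pY M) (hR : RFacts c' X Y lo M pw L pX pY H₀)
    (hO : (NegativeTriangle c').OracleAnswers O) {P : ℕ} (hs : ∀ t, t < n * n → lo t + pw ≤ P - 1)
    (hpw1 : 1 ≤ pw) (hpwM : pw ≤ 4 * M + 1) {S H fd : ℕ → ℕ} {qs₀ : List (List ℕ)}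
    (hK : KRegs n F pX pY M L (nblk n) pw S) (hD : DataQ (mkQ X Y lo fd M pw L 0 0 0) F H₀ H)
    (hst0 : ∀ t, t < n * n → fd t = 0 ∨ 2 * pw ≤ fd t) (hfdM : ∀ t, t < n * n → fd t ≤ 4 * M + 1) :
    ∃ (S' H' fd' : ℕ → ℕ) (bs : List (NegativeTriangle c').Inst),
      ExecLE w O search ⟨merge S H, qs₀⟩ ⟨merge S' H', qs₀ ++ bs.map (NegativeTriangle c').encode⟩ (tSearch n L) ∧
      KRegs n F pX pY M L (nblk n) pw S' ∧ (∀ r, r < 20 → S' r = S r) ∧ DataQ (mkQ X Y lo fd' M pw L 0 0 0) F H₀ H' ∧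
      (∀ t, t < n * n → fd' t = 0 ∨ pw ≤ fd' t) ∧ (∀ t, t < n * n → fd' t ≤ 4 * M + 1) ∧
      (∀ i j : Fin n, fd' (i * n + j) = pw ↔ tval X Y M P i j < lo (i * n + j) + pw) ∧
      bs.length ≤ qSearch n L ∧
      ∀ y ∈ bs, (NegativeTriangle c').size y = 3 * L ∧ ((NegativeTriangle c').encode y).length = 9 * (L * L) + 1 := by
  obtain ⟨hn, hpX, hpY, hpYF, hFw, hMw, hn3w⟩ := id hG
  have hL1 : 1 ≤ L := hR.hL0
  have hnb : nblk n ≤ n := nblk_le hn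
  have hnb2 : nblk n * nblk n ≤ n * n := Nat.mul_le_mul hnb hnb
  have hnb3 : nblk n * nblk n * nblk n ≤ n * n * n := Nat.mul_le_mul hnb2 hnb
  obtain ⟨S₁, hex₁, h40, h41, hS₁⟩ := searchInit_spec (w := w) (O := O) (H := H) (qs := qs₀) hK.r30 (by omega)
  have hK₁ : KRegs n F pX pY M L (nblk n) pw S₁ := hK.of_agree fun r hr => hS₁ r (by omega) (by omega)
  -- the invariant initially
  have hinv : SInv c' X Y lo M pw L pX pY F P H₀ qs₀ (qSearch n L) S ⟨merge S₁ H, qs₀⟩ := by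
    refine ⟨S₁, H, fd, [], 0, by simp, hK₁, fun r hr => hS₁ r (by omega) (by omega), h40, by rw [h41]; rfl,
      Nat.zero_le _, hD,
      fun t ht => (hst0 t ht).imp_right (fun h => by omega), hfdM, fun i j hij => ?_,
      fun tr' htr' => absurd htr' (Nat.not_lt_zero _), ?_, fun y hy => by simp at hy⟩
    · exfalso
      have hidx : (i : ℕ) * n + j < n * n := NegTriToAPSP.mul_add_lt_mul i.isLt j.isLt
      rcases hst0 _ hidx with h | h <;> omega
    · simp only [List.length_nil, Nat.zero_add, Nat.sub_zero]
      unfold qSearch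
      exact Nat.mul_le_mul_right _ (Nat.add_le_add_left (unfound_le n fd pw) _)
  -- the loop
  have hUe : unfoundMem n F pw (merge S₁ H) = unfound n fd pw :=
    unfoundMem_eq (q := mkQ X Y lo fd M pw L 0 0 0) (S := S₁) hD (by omega)
  have hU : unfoundMem n F pw (merge S₁ H) ≤ n * n := hUe ▸ unfound_le n fd pw
  obtain ⟨st', hloop, hinv', hexit⟩ := ExecLE.whilenz_potential' (w := w) (O := O) (x := .dir 41) (s := searchBody)
    (SInv c' X Y lo M pw L pX pY F P H₀ qs₀ (qSearch n L) S)
    (fun st => (st.mem 41 + unfoundMem n F pw st.mem) * (tIter L + 2))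
    (fun st hst hne => searchBody_spec hG hR hO hs hpwM hst hne) hinv
    (T := (nblk n * nblk n * nblk n + n * n) * (tIter L + 2) + 1) (by
      show (merge S₁ H 41 + unfoundMem n F pw (merge S₁ H)) * (tIter L + 2) + 1 ≤ _
      rw [merge_apply_of_lt (by norm_num), h41]
      exact Nat.add_le_add_right (Nat.mul_le_mul_right _ (Nat.add_le_add_left hU _)) _)
  obtain ⟨S', H', fd', bs, tr, rfl, hK', hlow', h40', h41', htr, hD', hst0', hfdM', hsound, hcomp, hbudget, hbs⟩ := hinv'
  have h41'' : S' 41 = 0 := by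
    rwa [show (Operand.dir 41).read (merge S' H') = S' 41 from merge_apply_of_lt (by norm_num)] at hexit
  have htr' : tr = nblk n * nblk n * nblk n := by rw [h41'] at h41''; omega
  refine ⟨S', H', fd', bs, (hex₁.execLE.seq hloop).mono (by unfold tSearch; omega), hK', hlow', hD', hst0', hfdM',
    fun i j => ⟨hsound i j, fun hlt => ?_⟩, ?_, hbs⟩
  · -- completeness
    refine found_of_tval_lt (L := L) (lo := lo) (fd := fd') (pw := pw) hR.hX hR.hY hL1 (fun bi bj bk hbi hbj hbk => ?_)
      (hs _ (NegTriToAPSP.mul_add_lt_mul i.isLt j.isLt)) hlt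
    have hLn : cubeRt n = L := hR.hL.symm
    have hbi' : bi < nblk n := by unfold nblk; rw [hLn]; exact hbi
    have hbj' : bj < nblk n := by unfold nblk; rw [hLn]; exact hbj
    have hbk' : bk < nblk n := by unfold nblk; rw [hLn]; exact hbk
    obtain ⟨e1, e2, e3, hlt3⟩ := triple_decode hbi' hbj' hbk'
    have := hcomp (bi * (nblk n * nblk n) + bj * nblk n + bk) (htr' ▸ hlt3)
    rwa [e1, e2, e3] at this
  · have : 1 ≤ 1 + 2 * Nat.size (L - 1) := by omega
    exact le_trans (Nat.le_add_right _ _) hbudget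

end SearchRun

end Literature.Computability.FineGrained.NegTriStep
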